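import Literature.NumberTheory.LFunctions.ResidueClassMeanSquare
import Literature.Analysis.FunctionSpaces.SaffariVaughanShift
import Mathlib.NumberTheory.Chebyshev
import HarnessLib

/-!
# Goldbach sums of `Λ_{q,a} * Λ_{q,b}` up to `N`: the discrete decomposition and the bilinear bound

Topic `Literature/NumberTheory/LFunctions`. Everything in this file is PROVED (theorems only).

For `(a, q) = (b, q) = 1` let `S₂(N) = ∑_{l + m ≤ N} Λ_{q,a}(l) Λ_{q,b}(m)` (`Λ_{q,a} = φ(q)Λ𝟙_{≡ a}`), so
that `S₂(N)/φ(q)²` is the summatory Goldbach count in the classes `a, b`. Writing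
`Ψ_b(k) = ∑_{m ≤ k} Λ_{q,b}(m) = (k − 1) + R_b(k)` (`k ≥ 1`) and summing by parts twice one gets the
exact decomposition (`S2_decomposition`)

  `S₂(M) = ψ₁(M − 1; Λ_{q,a}) + D_b(M − 2) + T₂(M)`,  `D_b(K) = ∑_{k ≤ K} R_b(k) = R₁,b(K+1) + K/2`,
  `T₂(M) = ∑_{l ≤ M−2} R_a(l) (R_b(M − l) − R_b(M − l − 1))`,

whose first two terms are controlled log-free by `abs_rieszMean_sub_le`, while the bilinear term,
averaged over `M ∈ (N, N + H]`, telescopes into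
`∑_l R_a(l)(R_b(N + H − l) − R_b(N − l))` (`sum_T2_eq_BIL`) and is bounded by Cauchy–Schwarz through
the mean squares of `R_a` (`setIntegral_Rrem_sq_le`) and of the additive difference
`R_b(u + H) − R_b(u)`, the latter obtained from the multiplicative ones
(`setIntegral_Rrem_mulShift_sq_le`) by the Saffari–Vaughan device
(`Literature.Analysis.FunctionSpaces.SaffariVaughan.setIntegral_addShift_sq_le`) on dyadic blocks.
Since `S₂` is non-decreasing, `S₂(N)` is squeezed between its averages over `(N − H − 1, N − 1]` and
`(N, N + H]` (`H = ⌊N^{σ₁}⌋`), which gives the main estimate of this file, `abs_S2_sub_le`: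
under `ZerosRealPartLE q σ₁`, `|S₂(N) − N²/2| ≤ C φ(q)² N^{1+σ₁}` as soon as
`N^{(1−σ₁)/2} ≥ (log q + 1)² (log N + 1)³` (any `q`).

## References

* G. Bhowmik, K. Halupczok, K. Matsumoto, Y. Suzuki, *Goldbach representations in arithmetic
  progressions and zeros of Dirichlet L-functions*, Mathematika 65 (2019), 57–97, Thm. 1 (1), §3
  (`BhowmikHalupczokMatsumotoSuzuki2019`) — the statement; the proof here is a mean-square variant.
* B. Saffari, R. C. Vaughan, Ann. Inst. Fourier 27 (1977), (6.19)–(6.21) (`SaffariVaughan1977`).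
* H. L. Montgomery, R. C. Vaughan, *Multiplicative Number Theory I*, §13.1 (`MontgomeryVaughan2007`).
-/

noncomputable section

open Complex Set Filter Topology Real MeasureTheory Finset
open ArithmeticFunction.vonMangoldt DirichletCharacter
open Literature.Analysis.FunctionSpaces.SaffariVaughan (integrableOn_Icc_of_bound)

namespace Literature.NumberTheory.LFunctions.ResidueRiesz

variable {q : ℕ} [NeZero q]

/-! ### Values at integers -/

omit [NeZero q] in
/-- `Λ_{q,b}(0) = 0`. [folklore] -/
theorem Lam_zero (b : ZMod q) : Lam b 0 = 0 := by
  simp [Lam, residueClass]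

omit [NeZero q] in
/-- `Λ_{q,b}(1) = 0`. [folklore] -/
theorem Lam_one (b : ZMod q) : Lam b 1 = 0 := by
  simp [Lam, residueClass]

/-- `Ψ_b(k) = ∑_{n ≤ k} Λ_{q,b}(n)` (a `range` sum; the `n = 0` term vanishes). [folklore] -/
def PsiN (b : ZMod q) (k : ℕ) : ℝ := ∑ n ∈ range (k + 1), Lam b n

omit [NeZero q] in
/-- `range (k+1)` sums of a sequence vanishing at `0` are `Ioc 0 k` sums. [folklore] -/
theorem sum_range_succ_eq_sum_Ioc {f : ℕ → ℝ} (hf : f 0 = 0) (k : ℕ) :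
    ∑ n ∈ range (k + 1), f n = ∑ n ∈ Ioc 0 k, f n := by
  induction k with
  | zero => simp [hf]
  | succ k ih => rw [sum_range_succ, ih, Finset.sum_Ioc_succ_top (Nat.zero_le _)]

omit [NeZero q] in
/-- `Ψ_b(k) = ψ(k; Λ_{q,b})`. [folklore] -/
theorem PsiN_eq_psi (b : ZMod q) (k : ℕ) : PsiN b k = ClassicalPsiData.psi (Lam b) k := by
  rw [PsiN, ClassicalPsiData.psi, Nat.floor_natCast, sum_range_succ_eq_sum_Ioc (Lam_zero b)]

omit [NeZero q] in
/-- `Ψ_b(0) = 0`. [folklore] -/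
theorem PsiN_zero (b : ZMod q) : PsiN b 0 = 0 := by simp [PsiN, Lam_zero]

omit [NeZero q] in
/-- `Ψ_b(k+1) = Ψ_b(k) + Λ_{q,b}(k+1)`. [folklore] -/
theorem PsiN_succ (b : ZMod q) (k : ℕ) : PsiN b (k + 1) = PsiN b k + Lam b (k + 1) := by
  rw [PsiN, sum_range_succ, ← PsiN]

omit [NeZero q] in
/-- `Ψ_b ≥ 0`. [folklore] -/
theorem PsiN_nonneg (b : ZMod q) (k : ℕ) : 0 ≤ PsiN b k := sum_nonneg fun n _ ↦ Lam_nonneg b n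

omit [NeZero q] in
/-- `R_b(u) = 0` for `u < 1`. [folklore] -/
theorem Rrem_of_lt_one (b : ZMod q) {u : ℝ} (hu : u < 1) : Rrem b u = 0 := by
  rw [Rrem, ClassicalPsiData.psi, Nat.floor_eq_zero.2 hu, max_eq_right (by linarith)]
  simp

omit [NeZero q] in
/-- `R_b(k) = Ψ_b(k) − (k − 1)` for integers `k ≥ 1`. [folklore] -/
theorem Rrem_natCast (b : ZMod q) {k : ℕ} (hk : 1 ≤ k) : Rrem b k = PsiN b k - ((k : ℝ) - 1) := by
  rw [Rrem_eq b (by exact_mod_cast hk), PsiN_eq_psi]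

omit [NeZero q] in
/-- `R_b(1) = 0`. [folklore] -/
theorem Rrem_natCast_one (b : ZMod q) : Rrem b 1 = 0 := by
  have := Rrem_natCast b (k := 1) le_rfl
  rw [Nat.cast_one] at this
  rw [this, PsiN_succ, PsiN_zero, Lam_one]; ring

omit [NeZero q] in
/-- On `[l, l+1)` (`l ≥ 1` an integer) `ψ` is constant, so `R_b(u) = R_b(l) − (u − l)`. [folklore] -/
theorem Rrem_eq_on_Ico (b : ZMod q) {l : ℕ} (hl : 1 ≤ l) {u : ℝ} (hu : u ∈ Ico (l : ℝ) (l + 1)) :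
    Rrem b u = Rrem b l - (u - l) := by
  have hl' : (1 : ℝ) ≤ l := by exact_mod_cast hl
  have hfl : ⌊u⌋₊ = l := Nat.floor_eq_iff (by linarith [hu.1]) |>.2 ⟨hu.1, hu.2⟩
  rw [Rrem_eq b (hl'.trans hu.1), Rrem_eq b hl', ClassicalPsiData.psi, ClassicalPsiData.psi, hfl,
    Nat.floor_natCast]
  ring

omit [NeZero q] in
/-- For integers `m ≥ 1`, `H`, and `u ∈ [m, m+1)`: `R_b(u + H) − R_b(u) = R_b(m + H) − R_b(m)`. [folklore] -/
theorem Rrem_addShift_eq_on_Ico (b : ZMod q) {m : ℕ} (hm : 1 ≤ m) (H : ℕ) {u : ℝ}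
    (hu : u ∈ Ico (m : ℝ) (m + 1)) :
    Rrem b (u + H) - Rrem b u = Rrem b ((m + H : ℕ) : ℝ) - Rrem b m := by
  have h1 := Rrem_eq_on_Ico b hm hu
  have h2 := Rrem_eq_on_Ico b (l := m + H) (by omega) (u := u + H)
    ⟨by push_cast; linarith [hu.1], by push_cast; linarith [hu.2]⟩
  rw [h1, h2]; push_cast; ring

/-! ### `S₂(N)` and its first decomposition -/

/-- `S₂(N) = ∑_{n ≤ N} ∑_{l + m = n} Λ_{q,a}(l) Λ_{q,b}(m)`. [folklore] -/
def S2 (a b : ZMod q) (N : ℕ) : ℝ :=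
  ∑ n ∈ range (N + 1), ∑ lm ∈ antidiagonal n, Lam a lm.1 * Lam b lm.2

omit [NeZero q] in
/-- `S₂(N) = ∑_{l ≤ N} Λ_{q,a}(l) Ψ_b(N − l)`. [folklore] -/
theorem S2_eq_sum_PsiN (a b : ZMod q) (N : ℕ) :
    S2 a b N = ∑ l ∈ range (N + 1), Lam a l * PsiN b (N - l) := by
  induction N with
  | zero => simp [S2, PsiN_zero, Lam_zero]
  | succ N ih =>
      rw [S2, sum_range_succ, ← S2, ih, Finset.Nat.sum_antidiagonal_eq_sum_range_succ
        (fun i j ↦ Lam a i * Lam b j) (N + 1),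
        sum_range_succ (fun k ↦ Lam a k * Lam b (N + 1 - k)) (N + 1),
        sum_range_succ (fun l ↦ Lam a l * PsiN b (N + 1 - l)) (N + 1)]
      simp only [Nat.sub_self, PsiN_zero, Lam_zero, mul_zero, add_zero]
      rw [← sum_add_distrib]
      refine sum_congr rfl fun l hl ↦ ?_
      rw [Finset.mem_range] at hl
      rw [show N + 1 - l = (N - l) + 1 by omega, PsiN_succ]
      ring

omit [NeZero q] in
/-- `S₂` is non-decreasing in `N`. [folklore] -/
theorem S2_mono (a b : ZMod q) : Monotone (S2 a b) := by
  refine monotone_nat_of_le_succ fun N ↦ ?_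
  show S2 a b N ≤ S2 a b (N + 1)
  rw [S2, S2, sum_range_succ _ (N + 1)]
  exact le_add_of_nonneg_right (sum_nonneg fun lm _ ↦ mul_nonneg (Lam_nonneg a _) (Lam_nonneg b _))

omit [NeZero q] in
/-- `S₂ ≥ 0`. [folklore] -/
theorem S2_nonneg (a b : ZMod q) (N : ℕ) : 0 ≤ S2 a b N :=
  sum_nonneg fun _ _ ↦ sum_nonneg fun _ _ ↦ mul_nonneg (Lam_nonneg a _) (Lam_nonneg b _)

omit [NeZero q] in
/-- The trivial bound `S₂(N) ≤ Ψ_a(N) Ψ_b(N)`. [folklore] -/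
theorem S2_le_PsiN_mul (a b : ZMod q) (N : ℕ) : S2 a b N ≤ PsiN a N * PsiN b N := by
  rw [S2_eq_sum_PsiN, PsiN, sum_mul]
  refine sum_le_sum fun l hl ↦ mul_le_mul_of_nonneg_left ?_ (Lam_nonneg a l)
  simp only [PsiN]
  exact sum_le_sum_of_subset_of_nonneg (range_subset_range.2 (by omega)) fun n _ _ ↦ Lam_nonneg b n

omit [NeZero q] in
/-- The Riesz mean at an integer as a `range` sum. [folklore] -/
theorem rieszMean_natCast (a : ZMod q) (K : ℕ) :
    ClassicalPsiData.rieszMean (Lam a) K = ∑ n ∈ range (K + 1), Lam a n * ((K : ℝ) - n) := by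
  rw [ClassicalPsiData.rieszMean, Nat.floor_natCast, sum_range_succ_eq_sum_Ioc (by simp [Lam_zero])]

omit [NeZero q] in
/-- **First decomposition**: for `M ≥ 1`,
`S₂(M) = ψ₁(M−1; Λ_{q,a}) + ∑_{l < M} Λ_{q,a}(l) R_b(M − l)`. [folklore] -/
theorem S2_eq_rieszMean_add (a b : ZMod q) {M : ℕ} (hM : 1 ≤ M) :
    S2 a b M = ClassicalPsiData.rieszMean (Lam a) ((M : ℝ) - 1) +
      ∑ l ∈ range M, Lam a l * Rrem b ((M : ℝ) - l) := by
  have hcast : ((M : ℝ) - 1) = ((M - 1 : ℕ) : ℝ) := by rw [Nat.cast_sub hM, Nat.cast_one]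
  rw [hcast, rieszMean_natCast, Nat.sub_add_cancel hM, S2_eq_sum_PsiN, sum_range_succ, Nat.sub_self,
    PsiN_zero, mul_zero, add_zero, ← sum_add_distrib]
  refine sum_congr rfl fun l hl ↦ ?_
  rw [Finset.mem_range] at hl
  have h1 : 1 ≤ M - l := by omega
  have hc : ((M - l : ℕ) : ℝ) = (M : ℝ) - l := by rw [Nat.cast_sub hl.le]
  have hR := Rrem_natCast b h1
  rw [hc] at hR
  rw [hR, Nat.cast_sub hM]
  push_cast
  ring

/-! ### Summation by parts -/

omit [NeZero q] in
/-- Abel summation: `∑_{l ≤ L} (F(l) − F(l−1)) g(l) = F(L) g(L) + ∑_{l < L} F(l)(g(l) − g(l+1))`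
for `F(0) = 0` (with `F(0 − 1) = F(0)`). [folklore] -/
theorem sum_range_succ_sub_mul (F g : ℕ → ℝ) (hF : F 0 = 0) (L : ℕ) :
    ∑ l ∈ range (L + 1), (F l - F (l - 1)) * g l = F L * g L + ∑ l ∈ range L, F l * (g l - g (l + 1)) := by
  induction L with
  | zero => simp [hF]
  | succ L ih =>
      rw [sum_range_succ, ih, sum_range_succ, Nat.add_sub_cancel]
      ring

omit [NeZero q] in
/-- `∑_{k<K+1} k = K(K+1)/2` in `ℝ`. [folklore] -/
theorem sum_range_natCast (K : ℕ) : ∑ k ∈ range (K + 1), (k : ℝ) = (K : ℝ) * (K + 1) / 2 := by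
  induction K with
  | zero => simp
  | succ K ih => rw [sum_range_succ, ih]; push_cast; ring

/-- `D_b(K) = ∑_{k ≤ K} R_b(k)`. [folklore] -/
def Dsum (b : ZMod q) (K : ℕ) : ℝ := ∑ k ∈ range (K + 1), Rrem b k

/-- The bilinear term `T₂(M) = ∑_{l ≤ M−2} R_a(l)(R_b(M − l) − R_b(M − l − 1))`. [folklore] -/
def T2 (a b : ZMod q) (M : ℕ) : ℝ :=
  ∑ l ∈ range (M - 1), Rrem a l * (Rrem b ((M : ℝ) - l) - Rrem b ((M : ℝ) - l - 1))

omit [NeZero q] in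
/-- `Λ_{q,a}(l) = 𝟙_{l ≥ 2} + (R_a(l) − R_a(l−1))` for `l ≥ 1` (and both sides interpreted with
`R_a(0) = R_a(1) = 0`): precisely `Λ_{q,a}(l) = (R_a(l) − R_a(l−1)) + (if 2 ≤ l then 1 else 0)`. [folklore] -/
theorem Lam_eq_Rrem_sub (a : ZMod q) (l : ℕ) :
    Lam a l = (Rrem a l - Rrem a ((l - 1 : ℕ) : ℝ)) + (if 2 ≤ l then 1 else 0) := by
  have h0 : Rrem a 0 = 0 := Rrem_of_lt_one a (by norm_num)
  rcases Nat.lt_or_ge l 2 with hl | hl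
  · interval_cases l
    · simp [Lam_zero, h0]
    · simp [Lam_one, Rrem_natCast_one, h0]
  · rw [if_pos hl, Rrem_natCast a (by omega), Rrem_natCast a (k := l - 1) (by omega),
      show l = (l - 1) + 1 from (Nat.sub_add_cancel (by omega)).symm, PsiN_succ]
    simp only [Nat.add_sub_cancel]
    push_cast
    ring

omit [NeZero q] in
/-- **Second decomposition**: for `M ≥ 2`,
`∑_{l < M} Λ_{q,a}(l) R_b(M − l) = D_b(M − 2) + T₂(M)`. [folklore] -/
theorem sum_Lam_Rrem_eq (a b : ZMod q) {M : ℕ} (hM : 2 ≤ M) :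
    ∑ l ∈ range M, Lam a l * Rrem b ((M : ℝ) - l) = Dsum b (M - 2) + T2 a b M := by
  -- split `Λ = ΔR_a + 𝟙_{≥ 2}`
  have hsplit : ∑ l ∈ range M, Lam a l * Rrem b ((M : ℝ) - l) =
      ∑ l ∈ range M, (Rrem a l - Rrem a ((l - 1 : ℕ) : ℝ)) * Rrem b ((M : ℝ) - l) +
        ∑ l ∈ range M, (if 2 ≤ l then (1 : ℝ) else 0) * Rrem b ((M : ℝ) - l) := by
    rw [← sum_add_distrib]
    exact sum_congr rfl fun l _ ↦ by rw [Lam_eq_Rrem_sub]; ring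
  -- the indicator part is `D_b(M-2)` after reflection
  have hind : ∑ l ∈ range M, (if 2 ≤ l then (1 : ℝ) else 0) * Rrem b ((M : ℝ) - l) = Dsum b (M - 2) := by
    obtain ⟨K, rfl⟩ : ∃ K, M = K + 2 := ⟨M - 2, by omega⟩
    rw [Nat.add_sub_cancel, Dsum, ← Finset.sum_range_reflect, sum_range_succ, sum_range_succ,
      sum_range_succ']
    have h0 : Rrem b ((0 : ℕ) : ℝ) = 0 := Rrem_of_lt_one b (by norm_num)
    rw [if_neg (show ¬ (2 ≤ K + 2 - 1 - K) by omega), if_neg (show ¬ (2 ≤ K + 2 - 1 - (K + 1)) by omega),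
      zero_mul, zero_mul, add_zero, add_zero, h0, add_zero]
    refine sum_congr rfl fun j hj ↦ ?_
    rw [Finset.mem_range] at hj
    rw [if_pos (by omega), one_mul]
    congr 1
    rw [Nat.cast_sub (by omega)]; push_cast; ring
  -- the `ΔR_a` part is `T₂(M)` by Abel summation
  have hdiff : ∑ l ∈ range M, (Rrem a l - Rrem a ((l - 1 : ℕ) : ℝ)) * Rrem b ((M : ℝ) - l) = T2 a b M := by
    obtain ⟨L, rfl⟩ : ∃ L, M = L + 1 := ⟨M - 1, by omega⟩
    have h0 : Rrem a ((0 : ℕ) : ℝ) = 0 := Rrem_of_lt_one a (by norm_num)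
    have hA := sum_range_succ_sub_mul (fun l : ℕ ↦ Rrem a (l : ℝ)) (fun l : ℕ ↦ Rrem b (((L + 1 : ℕ) : ℝ) - l)) h0 L
    rw [hA, T2, Nat.add_sub_cancel]
    have hg : Rrem b (((L + 1 : ℕ) : ℝ) - (L : ℕ)) = 0 := by
      rw [show ((L + 1 : ℕ) : ℝ) - (L : ℕ) = 1 by push_cast; ring]; exact Rrem_natCast_one b
    rw [hg, mul_zero, zero_add]
    refine sum_congr rfl fun l _ ↦ ?_
    push_cast
    ring_nf
  rw [hsplit, hind, hdiff, add_comm]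

omit [NeZero q] in
/-- **The decomposition**: for `M ≥ 2`, `S₂(M) = ψ₁(M − 1; Λ_{q,a}) + D_b(M − 2) + T₂(M)`. [folklore] -/
theorem S2_decomposition (a b : ZMod q) {M : ℕ} (hM : 2 ≤ M) :
    S2 a b M = ClassicalPsiData.rieszMean (Lam a) ((M : ℝ) - 1) + Dsum b (M - 2) + T2 a b M := by
  rw [S2_eq_rieszMean_add a b (by omega), sum_Lam_Rrem_eq a b hM, add_assoc]

/-! ### `D_b` in terms of the Riesz mean -/

omit [NeZero q] in
/-- `∑_{k ≤ K} Ψ_b(k) = ψ₁(K + 1; Λ_{q,b})`. [folklore] -/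
theorem sum_PsiN_eq_rieszMean (b : ZMod q) (K : ℕ) :
    ∑ k ∈ range (K + 1), PsiN b k = ClassicalPsiData.rieszMean (Lam b) ((K + 1 : ℕ) : ℝ) := by
  rw [rieszMean_natCast]
  induction K with
  | zero => simp [PsiN_zero, Lam_zero, Lam_one, sum_range_succ]
  | succ K ih =>
      rw [sum_range_succ, ih, sum_range_succ _ (K + 1 + 1)]
      simp only [sub_self, mul_zero, add_zero]
      rw [PsiN, ← sum_add_distrib]
      refine sum_congr rfl fun n _ ↦ ?_
      push_cast; ring

omit [NeZero q] in
/-- **`D_b(K) = R₁,b(K+1) + K/2`**, where `R₁,b(x) = ψ₁(x; Λ_{q,b}) − (x − 1)²/2` (`R1`). [folklore] -/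
theorem Dsum_eq (b : ZMod q) (K : ℕ) : Dsum b K = R1 b ((K + 1 : ℕ) : ℝ) + (K : ℝ) / 2 := by
  have h1 : Dsum b K = ∑ k ∈ range (K + 1), PsiN b k - ∑ k ∈ range (K + 1), ((k : ℝ) - 1) - 1 := by
    -- `R_b(k) = Ψ_b(k) − (k − 1)` for `k ≥ 1`; at `k = 0`: `R_b(0) = 0`, `Ψ_b(0) − (0 − 1) = 1`
    rw [Dsum, ← sum_sub_distrib, sum_range_succ', sum_range_succ' (fun k ↦ PsiN b k - ((k : ℝ) - 1))]
    rw [Rrem_of_lt_one b (by norm_num : ((0 : ℕ) : ℝ) < 1), PsiN_zero]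
    have : ∀ k ∈ range K, Rrem b ((k + 1 : ℕ) : ℝ) = PsiN b (k + 1) - (((k + 1 : ℕ) : ℝ) - 1) :=
      fun k _ ↦ Rrem_natCast b (by omega)
    rw [sum_congr rfl this]
    push_cast; ring
  have h2 : ∑ k ∈ range (K + 1), ((k : ℝ) - 1) = (K : ℝ) * (K + 1) / 2 - (K + 1) := by
    rw [sum_sub_distrib, sum_range_natCast, sum_const, card_range, nsmul_eq_mul, mul_one]
    push_cast; ring
  rw [h1, h2, sum_PsiN_eq_rieszMean, R1]
  push_cast; ring

/-! ### Averaging `T₂` over `M ∈ (N, N + H]`: telescoping -/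

omit [NeZero q] in
/-- Terms of `T₂(M)` with `l ≥ M − 1` vanish, so the range may be extended. [folklore] -/
theorem T2_eq_sum_range (a b : ZMod q) (M L : ℕ) (hL : M - 1 ≤ L) :
    T2 a b M = ∑ l ∈ range L, Rrem a l * (Rrem b ((M : ℝ) - l) - Rrem b ((M : ℝ) - l - 1)) := by
  rw [T2]
  refine sum_subset (range_subset_range.2 hL) fun l _ hl' ↦ ?_
  rw [Finset.mem_range, not_lt] at hl'
  have hle : (M : ℝ) - l ≤ 1 := by
    have : (M : ℝ) ≤ l + 1 := by exact_mod_cast (show M ≤ l + 1 by omega)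
    linarith
  have h1 : Rrem b ((M : ℝ) - l) = 0 := by
    rcases lt_or_eq_of_le hle with h | h
    · exact Rrem_of_lt_one b h
    · rw [h]; exact Rrem_natCast_one b
  have h2 : Rrem b ((M : ℝ) - l - 1) = 0 := Rrem_of_lt_one b (by linarith)
  rw [h1, h2]; ring

/-- The averaged bilinear form `BIL = ∑_{l < N + H} R_a(l)(R_b(N + H − l) − R_b(N − l))`. [folklore] -/
def BIL (a b : ZMod q) (N H : ℕ) : ℝ :=
  ∑ l ∈ range (N + H), Rrem a l * (Rrem b ((N : ℝ) + H - l) - Rrem b ((N : ℝ) - l))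

omit [NeZero q] in
/-- **Telescoping**: `∑_{j < H} T₂(N + 1 + j) = BIL`. [folklore] -/
theorem sum_T2_eq_BIL (a b : ZMod q) (N H : ℕ) : ∑ j ∈ range H, T2 a b (N + 1 + j) = BIL a b N H := by
  have h : ∀ j ∈ range H, T2 a b (N + 1 + j) = ∑ l ∈ range (N + H),
      Rrem a l * (Rrem b ((N : ℝ) + ((j + 1 : ℕ) : ℝ) - l) - Rrem b ((N : ℝ) + (j : ℝ) - l)) := by
    intro j hj
    rw [Finset.mem_range] at hj
    rw [T2_eq_sum_range a b (N + 1 + j) (N + H) (by omega)]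
    refine sum_congr rfl fun l _ ↦ ?_
    congr 2
    · push_cast; ring
    · push_cast; ring
  rw [sum_congr rfl h, sum_comm, BIL]
  refine sum_congr rfl fun l _ ↦ ?_
  rw [← mul_sum, Finset.sum_range_sub (fun j : ℕ ↦ Rrem b ((N : ℝ) + (j : ℝ) - l)) H]
  simp

/-! ### Cauchy–Schwarz and the passage to integrals -/

omit [NeZero q] in
/-- `BIL² ≤ (∑_{l<N+H} R_a(l)²)(∑_{l<N+H} (R_b(N+H−l) − R_b(N−l))²)`. [folklore] -/
theorem BIL_sq_le (a b : ZMod q) (N H : ℕ) :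
    BIL a b N H ^ 2 ≤ (∑ l ∈ range (N + H), Rrem a l ^ 2) *
      ∑ l ∈ range (N + H), (Rrem b ((N : ℝ) + H - l) - Rrem b ((N : ℝ) - l)) ^ 2 :=
  Finset.sum_mul_sq_le_sq_mul_sq _ _ _

omit [NeZero q] in
/-- The second factor, split at `l = N` and reflected:
`∑_{l<N+H} (R_b(N+H−l) − R_b(N−l))² = ∑_{m=1}^{N} (R_b(m+H) − R_b(m))² + ∑_{k=1}^{H} R_b(k)²`
(for `l ≥ N`, `R_b(N − l) = 0`). [folklore] -/
theorem sum_shift_sq_eq (b : ZMod q) (N H : ℕ) :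
    ∑ l ∈ range (N + H), (Rrem b ((N : ℝ) + H - l) - Rrem b ((N : ℝ) - l)) ^ 2 =
      ∑ m ∈ range N, (Rrem b ((m + 1 + H : ℕ) : ℝ) - Rrem b ((m + 1 : ℕ) : ℝ)) ^ 2 +
        ∑ k ∈ range H, Rrem b ((k + 1 : ℕ) : ℝ) ^ 2 := by
  rw [sum_range_add]
  congr 1
  · rw [← Finset.sum_range_reflect]
    refine sum_congr rfl fun m hm ↦ ?_
    rw [Finset.mem_range] at hm
    have hc : ((N - 1 - m : ℕ) : ℝ) = (N : ℝ) - 1 - m := by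
      rw [Nat.cast_sub (by omega : m ≤ N - 1), Nat.cast_sub (by omega : 1 ≤ N)]; push_cast; ring
    rw [hc]
    congr 2
    · congr 1; push_cast; ring
    · congr 1; push_cast; ring
  · rw [← Finset.sum_range_reflect]
    refine sum_congr rfl fun k hk ↦ ?_
    rw [Finset.mem_range] at hk
    have hc : ((N + (H - 1 - k) : ℕ) : ℝ) = (N : ℝ) + H - (k + 1) := by
      rw [Nat.cast_add, Nat.cast_sub (by omega : k ≤ H - 1), Nat.cast_sub (by omega : 1 ≤ H)]
      push_cast; ring
    rw [hc]
    have hk1 : (k : ℝ) + 1 ≤ H := by exact_mod_cast (show k + 1 ≤ H by omega)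
    have h0 : Rrem b ((N : ℝ) - ((N : ℝ) + H - (k + 1))) = 0 := Rrem_of_lt_one b (by linarith)
    rw [h0, sub_zero]
    congr 2
    push_cast; ring


/-! ### From sums over integers to integrals -/

omit [NeZero q] in
/-- `R_b` is bounded on `(-∞, Z]`: `|R_b(u)| ≤ ψ(Z) + Z` (`Z ≥ 1`). [folklore] -/
theorem abs_Rrem_le' (b : ZMod q) {u Z : ℝ} (hZ : 1 ≤ Z) (huZ : u ≤ Z) :
    |Rrem b u| ≤ ClassicalPsiData.psi (Lam b) Z + Z := by
  rcases lt_or_ge u 1 with h | h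
  · rw [Rrem_of_lt_one b h, abs_zero]
    have := ClassicalPsiData.psi_nonneg (Lam_nonneg b) Z
    linarith
  · exact abs_Rrem_le b h huZ

omit [NeZero q] in
/-- `R_b²` is integrable on bounded intervals. [folklore] -/
theorem integrableOn_Rrem_sq (b : ZMod q) (c d : ℝ) : IntegrableOn (fun u ↦ Rrem b u ^ 2) (Icc c d) := by
  set Z : ℝ := max 1 |d| with hZ
  have hZ1 : 1 ≤ Z := le_max_left _ _
  refine integrableOn_Icc_of_bound ((measurable_Rrem b).pow_const 2)
    (M := (ClassicalPsiData.psi (Lam b) Z + Z) ^ 2) fun u hu ↦ ?_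
  show |Rrem b u ^ 2| ≤ (ClassicalPsiData.psi (Lam b) Z + Z) ^ 2
  rw [abs_of_nonneg (sq_nonneg _)]
  have huZ : u ≤ Z := (hu.2.trans (le_abs_self d)).trans (le_max_right _ _)
  have h := abs_Rrem_le' b hZ1 huZ
  have := sq_abs (Rrem b u)
  nlinarith [abs_nonneg (Rrem b u)]

omit [NeZero q] in
/-- `(R_b(· + H) − R_b)²` is integrable on bounded intervals. [folklore] -/
theorem integrableOn_addShift_sq (b : ZMod q) (H c d : ℝ) :
    IntegrableOn (fun u ↦ (Rrem b (u + H) - Rrem b u) ^ 2) (Icc c d) := by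
  set Z : ℝ := max 1 (|d| + |H|) with hZ
  have hZ1 : 1 ≤ Z := le_max_left _ _
  set B : ℝ := ClassicalPsiData.psi (Lam b) Z + Z with hB
  refine integrableOn_Icc_of_bound
    ((((measurable_Rrem b).comp (measurable_id.add_const H)).sub (measurable_Rrem b)).pow_const 2)
    (M := (2 * B) ^ 2) fun u hu ↦ ?_
  show |(Rrem b (u + H) - Rrem b u) ^ 2| ≤ (2 * B) ^ 2
  rw [abs_of_nonneg (sq_nonneg _)]
  have hZ2 : |d| + |H| ≤ Z := le_max_right _ _
  have h1 := abs_Rrem_le' b hZ1 (show u ≤ Z by linarith [hu.2, le_abs_self d, abs_nonneg H])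
  have h2 := abs_Rrem_le' b hZ1 (show u + H ≤ Z by linarith [hu.2, le_abs_self d, le_abs_self H])
  have h3 : |Rrem b (u + H) - Rrem b u| ≤ 2 * B := by
    have := abs_sub (Rrem b (u + H)) (Rrem b u); rw [hB]; linarith
  have := sq_abs (Rrem b (u + H) - Rrem b u)
  nlinarith [abs_nonneg (Rrem b (u + H) - Rrem b u)]

omit [NeZero q] in
/-- The unit intervals `[m, m+1)`, `1 ≤ m ≤ L`, are pairwise disjoint with union `[1, L+1)`. [folklore] -/
theorem biUnion_Ico_eq (L : ℕ) :
    (⋃ m ∈ Finset.Icc 1 L, Ico (m : ℝ) ((m : ℝ) + 1)) = Ico (1 : ℝ) ((L : ℝ) + 1) ∧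
    Set.Pairwise (↑(Finset.Icc 1 L) : Set ℕ)
      (Function.onFun Disjoint fun m : ℕ ↦ Ico (m : ℝ) ((m : ℝ) + 1)) := by
  constructor
  · ext u
    simp only [Set.mem_iUnion, Set.mem_Ico, Finset.mem_Icc, exists_prop]
    constructor
    · rintro ⟨m, ⟨hm1, hmL⟩, hmu, hum⟩
      have h1 : (1 : ℝ) ≤ m := by exact_mod_cast hm1
      have h2 : (m : ℝ) + 1 ≤ L + 1 := by exact_mod_cast Nat.succ_le_succ hmL
      exact ⟨h1.trans hmu, lt_of_lt_of_le hum h2⟩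
    · rintro ⟨hu1, huL⟩
      have hu0 : 0 ≤ u := by linarith
      refine ⟨⌊u⌋₊, ⟨?_, ?_⟩, Nat.floor_le hu0, Nat.lt_floor_add_one u⟩
      · exact Nat.le_floor (by exact_mod_cast hu1)
      · have : ⌊u⌋₊ < L + 1 := (Nat.floor_lt hu0).2 (by exact_mod_cast huL)
        omega
  · intro m _ m' _ hne
    show Disjoint (Ico (m : ℝ) ((m : ℝ) + 1)) (Ico (m' : ℝ) ((m' : ℝ) + 1))
    rw [Set.Ico_disjoint_Ico]
    rcases lt_or_gt_of_ne hne with h | h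
    · have : (m : ℝ) + 1 ≤ m' := by exact_mod_cast h
      exact (min_le_left _ _).trans (this.trans (le_max_right _ _))
    · have : (m' : ℝ) + 1 ≤ m := by exact_mod_cast h
      exact (min_le_right _ _).trans (this.trans (le_max_left _ _))

omit [NeZero q] in
/-- `∑_{m ∈ [1, N]} f(m) = ∑_{k < N} f(k+1)`. [folklore] -/
theorem sum_Icc_one_eq_sum_range (f : ℕ → ℝ) (N : ℕ) :
    ∑ m ∈ Finset.Icc 1 N, f m = ∑ k ∈ range N, f (k + 1) := by
  induction N with
  | zero => simp
  | succ N ih => rw [Finset.sum_Icc_succ_top (by omega), ih, sum_range_succ]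

omit [NeZero q] in
/-- **`∑_{m=1}^{L} R_b(m)² ≤ 2 ∫_1^{L+1} R_b(u)² du + 2L`** (on `[m, m+1)`, `R_b(m) = R_b(u) + (u − m)`). [folklore] -/
theorem sum_Rrem_sq_le (b : ZMod q) (L : ℕ) :
    ∑ m ∈ Finset.Icc 1 L, Rrem b m ^ 2 ≤ 2 * (∫ u in Icc (1 : ℝ) ((L : ℝ) + 1), Rrem b u ^ 2) + 2 * L := by
  -- per interval
  have hper : ∀ m ∈ Finset.Icc 1 L, Rrem b m ^ 2 ≤ 2 * (∫ u in Ico (m : ℝ) ((m : ℝ) + 1), Rrem b u ^ 2) + 2 := by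
    intro m hm
    rw [Finset.mem_Icc] at hm
    have hI : IntegrableOn (fun u ↦ Rrem b u ^ 2) (Ico (m : ℝ) ((m : ℝ) + 1)) :=
      (integrableOn_Rrem_sq b m (m + 1)).mono_set Ico_subset_Icc_self
    have hvol : volume.real (Ico (m : ℝ) ((m : ℝ) + 1)) = 1 := by
      rw [Measure.real, Real.volume_Ico, ENNReal.toReal_ofReal (by linarith)]; ring
    have hpt : ∀ u ∈ Ico (m : ℝ) ((m : ℝ) + 1), Rrem b m ^ 2 / 2 - 1 ≤ Rrem b u ^ 2 := by
      intro u hu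
      have h := Rrem_eq_on_Ico b hm.1 hu
      have hum : (u - m) ^ 2 ≤ 1 := by nlinarith [hu.1, hu.2]
      have hm' : Rrem b m = Rrem b u + (u - m) := by linarith
      rw [hm']
      nlinarith [sq_nonneg (Rrem b u - (u - m))]
    have h1 : ∫ _ in Ico (m : ℝ) ((m : ℝ) + 1), (Rrem b m ^ 2 / 2 - 1) ≤ ∫ u in Ico (m : ℝ) ((m : ℝ) + 1), Rrem b u ^ 2 :=
      setIntegral_mono_on (integrableOn_const (hs := by rw [Real.volume_Ico]; exact ENNReal.ofReal_ne_top))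
        hI measurableSet_Ico hpt
    rw [setIntegral_const, hvol, smul_eq_mul, one_mul] at h1
    calc Rrem b m ^ 2 = 2 * (Rrem b m ^ 2 / 2 - 1) + 2 := by ring
      _ ≤ 2 * (∫ u in Ico (m : ℝ) ((m : ℝ) + 1), Rrem b u ^ 2) + 2 := by gcongr
  obtain ⟨hU, hdisj⟩ := biUnion_Ico_eq L
  have hsum : ∑ m ∈ Finset.Icc 1 L, ∫ u in Ico (m : ℝ) ((m : ℝ) + 1), Rrem b u ^ 2 =
      ∫ u in Ico (1 : ℝ) ((L : ℝ) + 1), Rrem b u ^ 2 := by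
    rw [← integral_biUnion_finset (Finset.Icc 1 L) (fun m _ ↦ measurableSet_Ico) hdisj
      (fun m _ ↦ (integrableOn_Rrem_sq b m (m + 1)).mono_set Ico_subset_Icc_self), hU]
  have hmono : ∫ u in Ico (1 : ℝ) ((L : ℝ) + 1), Rrem b u ^ 2 ≤ ∫ u in Icc (1 : ℝ) ((L : ℝ) + 1), Rrem b u ^ 2 :=
    setIntegral_mono_set (integrableOn_Rrem_sq b 1 (L + 1))
      ((ae_restrict_iff' measurableSet_Icc).2 (ae_of_all _ fun u _ ↦ sq_nonneg _))
      (Eventually.of_forall Ico_subset_Icc_self)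
  calc ∑ m ∈ Finset.Icc 1 L, Rrem b m ^ 2
      ≤ ∑ m ∈ Finset.Icc 1 L, (2 * (∫ u in Ico (m : ℝ) ((m : ℝ) + 1), Rrem b u ^ 2) + 2) := Finset.sum_le_sum hper
    _ = 2 * (∑ m ∈ Finset.Icc 1 L, ∫ u in Ico (m : ℝ) ((m : ℝ) + 1), Rrem b u ^ 2) + 2 * L := by
        rw [Finset.sum_add_distrib, Finset.mul_sum, Finset.sum_const, Nat.card_Icc]; simp; ring
    _ ≤ _ := by rw [hsum]; linarith

omit [NeZero q] in
/-- **`∑_{m=1}^{N} (R_b(m+H) − R_b(m))² ≤ ∫_1^{N+1} (R_b(u+H) − R_b(u))² du`** (equality in fact: on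
`[m, m+1)` the difference is constant). [folklore] -/
theorem sum_addShift_sq_le (b : ZMod q) (N H : ℕ) :
    ∑ m ∈ Finset.Icc 1 N, (Rrem b ((m + H : ℕ) : ℝ) - Rrem b m) ^ 2 ≤
      ∫ u in Icc (1 : ℝ) ((N : ℝ) + 1), (Rrem b (u + H) - Rrem b u) ^ 2 := by
  have hper : ∀ m ∈ Finset.Icc 1 N, (Rrem b ((m + H : ℕ) : ℝ) - Rrem b m) ^ 2 =
      ∫ u in Ico (m : ℝ) ((m : ℝ) + 1), (Rrem b (u + H) - Rrem b u) ^ 2 := by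
    intro m hm
    rw [Finset.mem_Icc] at hm
    have hvol : volume.real (Ico (m : ℝ) ((m : ℝ) + 1)) = 1 := by
      rw [Measure.real, Real.volume_Ico, ENNReal.toReal_ofReal (by linarith)]; ring
    rw [setIntegral_congr_fun measurableSet_Ico (fun u hu ↦ by rw [Rrem_addShift_eq_on_Ico b hm.1 H hu]),
      setIntegral_const, hvol, one_smul]
  obtain ⟨hU, hdisj⟩ := biUnion_Ico_eq N
  have hsum : ∑ m ∈ Finset.Icc 1 N, ∫ u in Ico (m : ℝ) ((m : ℝ) + 1), (Rrem b (u + H) - Rrem b u) ^ 2 =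
      ∫ u in Ico (1 : ℝ) ((N : ℝ) + 1), (Rrem b (u + H) - Rrem b u) ^ 2 := by
    rw [← integral_biUnion_finset (Finset.Icc 1 N) (fun m _ ↦ measurableSet_Ico) hdisj
      (fun m _ ↦ (integrableOn_addShift_sq b H m (m + 1)).mono_set Ico_subset_Icc_self), hU]
  rw [Finset.sum_congr rfl hper, hsum]
  exact setIntegral_mono_set (integrableOn_addShift_sq b H 1 (N + 1))
    ((ae_restrict_iff' measurableSet_Icc).2 (ae_of_all _ fun u _ ↦ sq_nonneg _))
    (Eventually.of_forall Ico_subset_Icc_self)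

omit [NeZero q] in
/-- `range` form: `∑_{l < L} R_a(l)² ≤ 2∫_1^{L} R_a² + 2L` (`L ≥ 1`; the `l = 0` term vanishes). [folklore] -/
theorem sum_range_Rrem_sq_le (a : ZMod q) {L : ℕ} (hL : 1 ≤ L) :
    ∑ l ∈ range L, Rrem a l ^ 2 ≤ 2 * (∫ u in Icc (1 : ℝ) (L : ℝ), Rrem a u ^ 2) + 2 * L := by
  obtain ⟨K, rfl⟩ : ∃ K, L = K + 1 := ⟨L - 1, by omega⟩
  have h0 : Rrem a ((0 : ℕ) : ℝ) = 0 := Rrem_of_lt_one a (by norm_num)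
  rw [sum_range_succ', h0, ← sum_Icc_one_eq_sum_range (fun m : ℕ ↦ Rrem a m ^ 2) K]
  have := sum_Rrem_sq_le a K
  push_cast
  nlinarith [this]

omit [NeZero q] in
/-- `range` form: `∑_{m<N} (R_b(m+1+H) − R_b(m+1))² ≤ ∫_1^{N+1} (R_b(u+H) − R_b(u))²`. [folklore] -/
theorem sum_range_addShift_sq_le (b : ZMod q) (N H : ℕ) :
    ∑ m ∈ range N, (Rrem b ((m + 1 + H : ℕ) : ℝ) - Rrem b ((m + 1 : ℕ) : ℝ)) ^ 2 ≤
      ∫ u in Icc (1 : ℝ) ((N : ℝ) + 1), (Rrem b (u + H) - Rrem b u) ^ 2 := by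
  rw [← sum_Icc_one_eq_sum_range (fun m : ℕ ↦ (Rrem b ((m + H : ℕ) : ℝ) - Rrem b m) ^ 2) N]
  exact sum_addShift_sq_le b N H

omit [NeZero q] in
/-- `range` form: `∑_{k<H} R_b(k+1)² ≤ 2∫_1^{H+1} R_b² + 2H`. [folklore] -/
theorem sum_range_Rrem_succ_sq_le (b : ZMod q) (H : ℕ) :
    ∑ k ∈ range H, Rrem b ((k + 1 : ℕ) : ℝ) ^ 2 ≤ 2 * (∫ u in Icc (1 : ℝ) ((H : ℝ) + 1), Rrem b u ^ 2) + 2 * H := by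
  rw [← sum_Icc_one_eq_sum_range (fun m : ℕ ↦ Rrem b m ^ 2) H]
  exact sum_Rrem_sq_le b H

/-! ### Mean squares without weights on `[1, X]` and on blocks -/

/-- `∫_1^X R_a(u)² du ≤ X^{2σ'+1} C_{E1} φ² (log q+1)²/ε` (`σ' = σ₁ + ε`). [folklore] -/
theorem setIntegral_Rrem_sq_le_pow {a : ZMod q} (ha : IsUnit a) {σ₁ : ℝ} (hσ₁ : 1 / 2 ≤ σ₁)
    (hZ : ZerosRealPartLE q σ₁) {ε : ℝ} (hε : 0 < ε) (hσ'1 : σ₁ + ε < 1) {X : ℝ} (hX : 1 ≤ X) :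
    ∫ u in Icc 1 X, Rrem a u ^ 2 ≤
      X ^ (2 * (σ₁ + ε) + 1) * (CE1 * (q.totient : ℝ) ^ 2 * (Real.log q + 1) ^ 2 / ε) := by
  obtain ⟨hIw, hB⟩ := setIntegral_Rrem_sq_le ha hσ₁ hZ hε hσ'1 hX
  set p : ℝ := 2 * (σ₁ + ε) + 1 with hp
  have hp0 : 0 < p := by rw [hp]; linarith
  have hX0 : 0 < X := by linarith
  have hXp : 0 < X ^ p := Real.rpow_pos_of_pos hX0 p
  have hpt : ∀ u ∈ Icc 1 X, Rrem a u ^ 2 ≤ X ^ p * (Rrem a u ^ 2 * u ^ (-p)) := by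
    intro u hu
    have hu0 : 0 < u := by linarith [hu.1]
    have h1 : X ^ (-p) ≤ u ^ (-p) := by
      rw [Real.rpow_neg hX0.le, Real.rpow_neg hu0.le]
      exact inv_anti₀ (Real.rpow_pos_of_pos hu0 p) (Real.rpow_le_rpow hu0.le hu.2 hp0.le)
    have h2 : X ^ p * X ^ (-p) = 1 := by rw [Real.rpow_neg hX0.le, mul_inv_cancel₀ hXp.ne']
    calc Rrem a u ^ 2 = Rrem a u ^ 2 * (X ^ p * X ^ (-p)) := by rw [h2, mul_one]
      _ ≤ Rrem a u ^ 2 * (X ^ p * u ^ (-p)) := by gcongr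
      _ = X ^ p * (Rrem a u ^ 2 * u ^ (-p)) := by ring
  have hneg : ∀ u : ℝ, u ^ (-p) = u ^ (-(2 * (σ₁ + ε) + 1)) := fun u ↦ by rw [hp]
  calc ∫ u in Icc 1 X, Rrem a u ^ 2 ≤ ∫ u in Icc 1 X, X ^ p * (Rrem a u ^ 2 * u ^ (-p)) :=
        setIntegral_mono_on (integrableOn_Rrem_sq a 1 X) (hIw.const_mul _) measurableSet_Icc hpt
    _ = X ^ p * ∫ u in Icc 1 X, Rrem a u ^ 2 * u ^ (-p) := MeasureTheory.integral_const_mul _ _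
    _ ≤ X ^ p * (CE1 * (q.totient : ℝ) ^ 2 * (Real.log q + 1) ^ 2 / ε) :=
        mul_le_mul_of_nonneg_left hB hXp.le

omit [NeZero q] in
/-- Uniformity in the shift length: for `0 < θ ≤ θ₀`,
`θ (1 + log(1/θ + 1))² ≤ 10 θ₀ (1 + log(1/θ₀ + 1))²`. [folklore] -/
theorem theta_weight_le {θ θ₀ : ℝ} (hθ : 0 < θ) (hθθ₀ : θ ≤ θ₀) :
    θ * (1 + Real.log (1 / θ + 1)) ^ 2 ≤ 10 * θ₀ * (1 + Real.log (1 / θ₀ + 1)) ^ 2 := by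
  have hθ₀0 : 0 < θ₀ := lt_of_lt_of_le hθ hθθ₀
  set t : ℝ := θ / θ₀ with ht
  have ht0 : 0 < t := by positivity
  have ht1 : t ≤ 1 := by rw [ht, div_le_one hθ₀0]; exact hθθ₀
  have hθt : θ = θ₀ * t := by rw [ht]; field_simp
  set A : ℝ := Real.log (1 / θ₀ + 1) with hA
  set B : ℝ := Real.log (1 / t) with hB
  have hA0 : 0 ≤ A := Real.log_nonneg (by have h' : (0 : ℝ) < 1 / θ₀ := one_div_pos.2 hθ₀0; linarith)
  have hB0 : 0 ≤ B := Real.log_nonneg (by rw [le_div_iff₀ ht0]; linarith)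
  -- `log(1/θ + 1) ≤ A + B`
  have hlog : Real.log (1 / θ + 1) ≤ A + B := by
    rw [hA, hB, ← Real.log_mul (by positivity) (by positivity)]
    refine Real.log_le_log (by positivity) ?_
    rw [hθt]
    have : 1 / (θ₀ * t) + 1 ≤ (1 / θ₀ + 1) * (1 / t) ↔ 1 ≤ 1 / t := by
      constructor <;> intro h <;> nlinarith [show 1 / (θ₀ * t) = 1 / θ₀ * (1 / t) by field_simp]
    exact this.2 (by rw [le_div_iff₀ ht0]; linarith)
  -- `t B² ≤ 4`
  have htB : t * B ^ 2 ≤ 4 := by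
    have h1 : B ≤ 2 * (1 / t) ^ (1 / 2 : ℝ) := by
      have := Real.log_le_rpow_div (show (0 : ℝ) ≤ 1 / t by positivity) (show (0 : ℝ) < 1 / 2 by norm_num)
      rw [hB]; linarith [show (1 / t) ^ (1 / 2 : ℝ) / (1 / 2) = 2 * (1 / t) ^ (1 / 2 : ℝ) by ring]
    have h2 : ((1 / t) ^ (1 / 2 : ℝ)) ^ 2 = 1 / t := by
      rw [← Real.rpow_two, ← Real.rpow_mul (by positivity)]; norm_num
    calc t * B ^ 2 ≤ t * (2 * (1 / t) ^ (1 / 2 : ℝ)) ^ 2 := by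
          exact mul_le_mul_of_nonneg_left (pow_le_pow_left₀ hB0 h1 2) ht0.le
      _ = 4 := by rw [mul_pow, h2]; field_simp; ring
  have h0 : 0 ≤ 1 + Real.log (1 / θ + 1) := by
    have h' : (0 : ℝ) < 1 / θ := one_div_pos.2 hθ
    have : 0 ≤ Real.log (1 / θ + 1) := Real.log_nonneg (by linarith)
    linarith
  calc θ * (1 + Real.log (1 / θ + 1)) ^ 2 ≤ θ * (1 + A + B) ^ 2 := by
        refine mul_le_mul_of_nonneg_left (pow_le_pow_left₀ h0 (by linarith) 2) hθ.le
    _ ≤ θ₀ * t * (2 * (1 + A) ^ 2 + 2 * B ^ 2) := by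
        rw [hθt]; refine mul_le_mul_of_nonneg_left ?_ (by positivity); nlinarith [sq_nonneg (1 + A - B)]
    _ = 2 * θ₀ * (1 + A) ^ 2 * t + 2 * θ₀ * (t * B ^ 2) := by ring
    _ ≤ 2 * θ₀ * (1 + A) ^ 2 * 1 + 2 * θ₀ * 4 := by gcongr
    _ ≤ 10 * θ₀ * (1 + A) ^ 2 := by nlinarith [sq_nonneg A, hθ₀0.le, mul_nonneg hθ₀0.le hA0]

omit [NeZero q] in
/-- `(R_b(·μ) − R_b)²` is integrable on bounded intervals. [folklore] -/
theorem integrableOn_mulShift_sq (b : ZMod q) (μ c d : ℝ) :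
    IntegrableOn (fun u ↦ (Rrem b (u * μ) - Rrem b u) ^ 2) (Icc c d) := by
  set Z : ℝ := max 1 (max |c| |d| * (1 + |μ|)) with hZ
  have hZ1 : 1 ≤ Z := le_max_left _ _
  set B : ℝ := ClassicalPsiData.psi (Lam b) Z + Z with hB
  refine integrableOn_Icc_of_bound
    ((((measurable_Rrem b).comp (measurable_id.mul_const μ)).sub (measurable_Rrem b)).pow_const 2)
    (M := (2 * B) ^ 2) fun u hu ↦ ?_
  show |(Rrem b (u * μ) - Rrem b u) ^ 2| ≤ (2 * B) ^ 2
  rw [abs_of_nonneg (sq_nonneg _)]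
  have hum : |u| ≤ max |c| |d| := abs_le_max_abs_abs hu.1 hu.2
  have hZ2 : max |c| |d| * (1 + |μ|) ≤ Z := le_max_right _ _
  have hm0 : 0 ≤ max |c| |d| := (abs_nonneg u).trans hum
  have h1 := abs_Rrem_le' b hZ1 (show u ≤ Z by nlinarith [le_abs_self u, abs_nonneg μ])
  have h2 := abs_Rrem_le' b hZ1 (show u * μ ≤ Z by
    nlinarith [le_abs_self (u * μ), abs_mul u μ, mul_le_mul_of_nonneg_right hum (abs_nonneg μ)])
  have h3 : |Rrem b (u * μ) - Rrem b u| ≤ 2 * B := by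
    have := abs_sub (Rrem b (u * μ)) (Rrem b u); rw [hB]; linarith
  have := sq_abs (Rrem b (u * μ) - Rrem b u)
  nlinarith [abs_nonneg (Rrem b (u * μ) - Rrem b u)]

/-- **Multiplicative differences on a block.** For `U ≥ 1`, `0 < θ₀ ≤ 1`, `μ ∈ [1, 1 + θ₀]`:
`∫_U^{3U} (R_b(uμ) − R_b(u))² du ≤ (3U)^{2σ'+1} C_{E2} φ² ((log q+1)² 10 θ₀ (1+log(1/θ₀+1))²/ε + 1/(3U))`.
[folklore] -/
theorem setIntegral_mulShift_sq_le_block {b : ZMod q} (hb : IsUnit b) {σ₁ : ℝ} (hσ₁ : 1 / 2 ≤ σ₁)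
    (hZ : ZerosRealPartLE q σ₁) {ε : ℝ} (hε : 0 < ε) (hσ'1 : σ₁ + ε < 1) {U : ℝ} (hU : 1 ≤ U)
    {θ₀ : ℝ} (hθ₀ : 0 < θ₀) (hθ₀1 : θ₀ ≤ 1) {μ : ℝ} (hμ : μ ∈ Icc 1 (1 + θ₀)) :
    ∫ u in Icc U (3 * U), (Rrem b (u * μ) - Rrem b u) ^ 2 ≤
      (3 * U) ^ (2 * (σ₁ + ε) + 1) * (CE2 * (q.totient : ℝ) ^ 2 *
        ((Real.log q + 1) ^ 2 * (10 * θ₀ * (1 + Real.log (1 / θ₀ + 1)) ^ 2) / ε + 1 / (3 * U))) := by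
  set p : ℝ := 2 * (σ₁ + ε) + 1 with hp
  have hp0 : 0 < p := by rw [hp]; linarith
  have hU0 : 0 < U := by linarith
  have h3U : 1 ≤ 3 * U := by linarith
  have h3Up : 0 < (3 * U) ^ p := Real.rpow_pos_of_pos (by linarith) p
  have hRHS0 : 0 ≤ (3 * U) ^ p * (CE2 * (q.totient : ℝ) ^ 2 *
      ((Real.log q + 1) ^ 2 * (10 * θ₀ * (1 + Real.log (1 / θ₀ + 1)) ^ 2) / ε + 1 / (3 * U))) := by
    have : 0 ≤ CE2 := by rw [CE2]; positivity
    positivity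
  rcases eq_or_lt_of_le hμ.1 with h1 | h1
  · -- `μ = 1`: the integrand vanishes
    rw [← h1]
    simp only [mul_one, sub_self, zero_pow two_ne_zero, integral_zero]
    exact hRHS0
  · set θ : ℝ := Real.log μ with hθdef
    have hθ0 : 0 < θ := Real.log_pos h1
    have hθle : θ ≤ θ₀ := by
      rw [hθdef]
      calc Real.log μ ≤ μ - 1 := Real.log_le_sub_one_of_pos (by linarith)
        _ ≤ θ₀ := by linarith [hμ.2]
    have hθ1 : θ ≤ 1 := hθle.trans hθ₀1
    have hexp : Real.exp θ = μ := by rw [hθdef, Real.exp_log (by linarith)]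
    obtain ⟨hIw, hB⟩ := setIntegral_Rrem_mulShift_sq_le hb hσ₁ hZ hε hσ'1 hθ0 hθ1 h3U
    rw [hexp] at hIw hB
    have hw := theta_weight_le hθ0 hθle
    -- compare the block integral with the weighted integral over `[1, 3U]`
    have hpt : ∀ u ∈ Icc U (3 * U), (Rrem b (u * μ) - Rrem b u) ^ 2 ≤
        (3 * U) ^ p * ((Rrem b (u * μ) - Rrem b u) ^ 2 * u ^ (-p)) := by
      intro u hu
      have hu0 : 0 < u := by linarith [hu.1]
      have e1 : (3 * U) ^ (-p) ≤ u ^ (-p) := by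
        rw [Real.rpow_neg (by linarith), Real.rpow_neg hu0.le]
        exact inv_anti₀ (Real.rpow_pos_of_pos hu0 p) (Real.rpow_le_rpow hu0.le hu.2 hp0.le)
      have e2 : (3 * U) ^ p * (3 * U) ^ (-p) = 1 := by rw [Real.rpow_neg (by linarith), mul_inv_cancel₀ h3Up.ne']
      calc (Rrem b (u * μ) - Rrem b u) ^ 2 = (Rrem b (u * μ) - Rrem b u) ^ 2 * ((3 * U) ^ p * (3 * U) ^ (-p)) := by
            rw [e2, mul_one]
        _ ≤ (Rrem b (u * μ) - Rrem b u) ^ 2 * ((3 * U) ^ p * u ^ (-p)) := by gcongr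
        _ = _ := by ring
    have hsub : Icc U (3 * U) ⊆ Icc 1 (3 * U) := Icc_subset_Icc hU le_rfl
    calc ∫ u in Icc U (3 * U), (Rrem b (u * μ) - Rrem b u) ^ 2
        ≤ ∫ u in Icc U (3 * U), (3 * U) ^ p * ((Rrem b (u * μ) - Rrem b u) ^ 2 * u ^ (-p)) :=
          setIntegral_mono_on (integrableOn_mulShift_sq b μ U (3 * U)) ((hIw.mono_set hsub).const_mul _)
            measurableSet_Icc hpt
      _ = (3 * U) ^ p * ∫ u in Icc U (3 * U), (Rrem b (u * μ) - Rrem b u) ^ 2 * u ^ (-p) :=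
          MeasureTheory.integral_const_mul _ _
      _ ≤ (3 * U) ^ p * ∫ u in Icc 1 (3 * U), (Rrem b (u * μ) - Rrem b u) ^ 2 * u ^ (-p) := by
          refine mul_le_mul_of_nonneg_left (setIntegral_mono_set hIw ?_ (Eventually.of_forall hsub)) h3Up.le
          exact (ae_restrict_iff' measurableSet_Icc).2 (ae_of_all _ fun u hu ↦
            mul_nonneg (sq_nonneg _) (Real.rpow_nonneg (by linarith [hu.1]) _))
      _ ≤ (3 * U) ^ p * (CE2 * (q.totient : ℝ) ^ 2 *
            ((Real.log q + 1) ^ 2 * θ * (1 + Real.log (1 / θ + 1)) ^ 2 / ε + 1 / (3 * U))) :=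
          mul_le_mul_of_nonneg_left hB h3Up.le
      _ ≤ _ := by
          refine mul_le_mul_of_nonneg_left ?_ h3Up.le
          have hC : 0 ≤ CE2 := by rw [CE2]; positivity
          refine mul_le_mul_of_nonneg_left ?_ (by positivity)
          have : (Real.log q + 1) ^ 2 * θ * (1 + Real.log (1 / θ + 1)) ^ 2 ≤
              (Real.log q + 1) ^ 2 * (10 * θ₀ * (1 + Real.log (1 / θ₀ + 1)) ^ 2) := by
            rw [mul_assoc]; exact mul_le_mul_of_nonneg_left hw (sq_nonneg _)
          have hε' := hε.le
          gcongr

/-- The block constant `C_blk = 8 C_{E2} φ² (540 H (log q+1)² (1 + log(X₀+1))²/ε + 9)`. [folklore] -/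
def Cblk (q : ℕ) (ε H X₀ : ℝ) : ℝ :=
  8 * CE2 * (q.totient : ℝ) ^ 2 * (540 * H * (Real.log q + 1) ^ 2 * (1 + Real.log (X₀ + 1)) ^ 2 / ε + 9)

omit [NeZero q] in
/-- `C_blk ≥ 0`. [folklore] -/
theorem Cblk_nonneg (q : ℕ) {ε H X₀ : ℝ} (hε : 0 < ε) (hH : 0 ≤ H) (hX₀ : 0 ≤ X₀) : 0 ≤ Cblk q ε H X₀ := by
  have : 0 ≤ CE2 := by rw [CE2]; positivity
  have : 0 ≤ Real.log (X₀ + 1) := Real.log_nonneg (by linarith)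
  unfold Cblk; positivity

/-- **Additive differences on a block** (Saffari–Vaughan + the multiplicative mean square): for an
integer `H ≥ 1` and real `U` with `4H ≤ U ≤ X₀`:
`∫_U^{2U} (R_b(u + H) − R_b(u))² du ≤ C_blk U^{2σ'}`. [folklore] -/
theorem setIntegral_addShift_sq_le_block {b : ZMod q} (hb : IsUnit b) {σ₁ : ℝ} (hσ₁ : 1 / 2 ≤ σ₁)
    (hZ : ZerosRealPartLE q σ₁) {ε : ℝ} (hε : 0 < ε) (hσ'1 : σ₁ + ε < 1) {H : ℕ} (hH : 1 ≤ H)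
    {U X₀ : ℝ} (hHU : 4 * (H : ℝ) ≤ U) (hUX : U ≤ X₀) :
    ∫ u in Icc U (2 * U), (Rrem b (u + H) - Rrem b u) ^ 2 ≤ Cblk q ε H X₀ * U ^ (2 * (σ₁ + ε)) := by
  have hH1 : (1 : ℝ) ≤ H := by exact_mod_cast hH
  have hU1 : 1 ≤ U := by linarith
  have hU0 : 0 < U := by linarith
  set θ₀ : ℝ := 2 * H / U with hθ₀
  have hθ₀0 : 0 < θ₀ := by positivity
  have hθ₀1 : θ₀ ≤ 1 := by rw [hθ₀, div_le_one hU0]; linarith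
  set p : ℝ := 2 * (σ₁ + ε) + 1 with hp
  set M : ℝ := (3 * U) ^ p * (CE2 * (q.totient : ℝ) ^ 2 *
      ((Real.log q + 1) ^ 2 * (10 * θ₀ * (1 + Real.log (1 / θ₀ + 1)) ^ 2) / ε + 1 / (3 * U))) with hM
  -- Saffari–Vaughan
  have hSV := Literature.Analysis.FunctionSpaces.SaffariVaughan.setIntegral_addShift_sq_le (measurable_Rrem b)
    (U := U) (H := (H : ℝ)) (B := ClassicalPsiData.psi (Lam b) (6 * U) + 6 * U) (M := M) (by positivity)
    (by linarith) (fun u hu ↦ abs_Rrem_le' b (by linarith) hu.2)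
    (fun μ hμ ↦ by
      rw [← hθ₀] at hμ
      exact setIntegral_mulShift_sq_le_block hb hσ₁ hZ hε hσ'1 hU1 hθ₀0 hθ₀1 hμ)
  refine hSV.trans ?_
  -- `8 M ≤ C_blk U^{2σ'}`
  have hC : 0 ≤ CE2 := by rw [CE2]; positivity
  have hp3 : p ≤ 3 := by rw [hp]; linarith
  have hp1 : 1 ≤ p := by rw [hp]; linarith
  have h3p : (3 : ℝ) ^ p ≤ 27 := by
    calc (3 : ℝ) ^ p ≤ 3 ^ (3 : ℝ) := Real.rpow_le_rpow_of_exponent_le (by norm_num) hp3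
      _ = 27 := by norm_num
  have hUp : (3 * U) ^ p = 3 ^ p * (U ^ (2 * (σ₁ + ε)) * U) := by
    rw [Real.mul_rpow (by norm_num) hU0.le, hp, Real.rpow_add hU0, Real.rpow_one]
  have hU2σ : 0 ≤ U ^ (2 * (σ₁ + ε)) := Real.rpow_nonneg hU0.le _
  -- the log: `log(1/θ₀ + 1) = log(U/(2H) + 1) ≤ log(X₀ + 1)`
  have hlog : Real.log (1 / θ₀ + 1) ≤ Real.log (X₀ + 1) := by
    refine Real.log_le_log (by positivity) ?_
    rw [hθ₀, one_div_div]
    have : U / (2 * H) ≤ U := by rw [div_le_iff₀ (by positivity)]; nlinarith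
    linarith
  have hlog0 : 0 ≤ Real.log (1 / θ₀ + 1) := Real.log_nonneg (by have h' : (0 : ℝ) < 1 / θ₀ := one_div_pos.2 hθ₀0; linarith)
  have hL : (1 + Real.log (1 / θ₀ + 1)) ^ 2 ≤ (1 + Real.log (X₀ + 1)) ^ 2 :=
    pow_le_pow_left₀ (by linarith) (by linarith) 2
  -- term by term
  have hterm1 : (3 * U) ^ p * ((Real.log q + 1) ^ 2 * (10 * θ₀ * (1 + Real.log (1 / θ₀ + 1)) ^ 2) / ε) ≤
      U ^ (2 * (σ₁ + ε)) * (540 * H * (Real.log q + 1) ^ 2 * (1 + Real.log (X₀ + 1)) ^ 2 / ε) := by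
    rw [hUp, hθ₀]
    have e : 3 ^ p * (U ^ (2 * (σ₁ + ε)) * U) * ((Real.log q + 1) ^ 2 * (10 * (2 * H / U) *
        (1 + Real.log (1 / (2 * H / U) + 1)) ^ 2) / ε) =
        U ^ (2 * (σ₁ + ε)) * (3 ^ p * 20 * H * (Real.log q + 1) ^ 2 *
          (1 + Real.log (1 / (2 * H / U) + 1)) ^ 2 / ε) := by
      field_simp
      ring
    rw [e]
    refine mul_le_mul_of_nonneg_left ?_ hU2σ
    rw [div_le_div_iff_of_pos_right hε]
    rw [← hθ₀]
    have h20 : (3 : ℝ) ^ p * 20 ≤ 540 := by linarith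
    calc 3 ^ p * 20 * H * (Real.log q + 1) ^ 2 * (1 + Real.log (1 / θ₀ + 1)) ^ 2
        ≤ 540 * H * (Real.log q + 1) ^ 2 * (1 + Real.log (1 / θ₀ + 1)) ^ 2 := by gcongr
      _ ≤ 540 * H * (Real.log q + 1) ^ 2 * (1 + Real.log (X₀ + 1)) ^ 2 := by gcongr
  have hterm2 : (3 * U) ^ p * (1 / (3 * U)) ≤ U ^ (2 * (σ₁ + ε)) * 9 := by
    rw [hUp]
    have e : 3 ^ p * (U ^ (2 * (σ₁ + ε)) * U) * (1 / (3 * U)) = U ^ (2 * (σ₁ + ε)) * (3 ^ p / 3) := by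
      field_simp
    rw [e]
    refine mul_le_mul_of_nonneg_left ?_ hU2σ
    rw [div_le_iff₀ (by norm_num)]; linarith
  calc 8 * M = 8 * (CE2 * (q.totient : ℝ) ^ 2) *
        ((3 * U) ^ p * ((Real.log q + 1) ^ 2 * (10 * θ₀ * (1 + Real.log (1 / θ₀ + 1)) ^ 2) / ε) +
          (3 * U) ^ p * (1 / (3 * U))) := by rw [hM]; ring
    _ ≤ 8 * (CE2 * (q.totient : ℝ) ^ 2) *
        (U ^ (2 * (σ₁ + ε)) * (540 * H * (Real.log q + 1) ^ 2 * (1 + Real.log (X₀ + 1)) ^ 2 / ε) +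
          U ^ (2 * (σ₁ + ε)) * 9) := by
        refine mul_le_mul_of_nonneg_left (add_le_add hterm1 hterm2) (by positivity)
    _ = Cblk q ε H X₀ * U ^ (2 * (σ₁ + ε)) := by rw [Cblk]; ring

/-! ### The additive mean square on `[1, X₀]`: initial range and dyadic blocks -/

omit [NeZero q] in
/-- Splitting `∫_{[x, X]} ≤ ∫_{[x, U]} + ∫_{[U, X]}` for a non-negative integrand. [folklore] -/
theorem setIntegral_Icc_split_le {f : ℝ → ℝ} {x U X : ℝ} (hxU : x ≤ U) (hUX : U ≤ X)
    (hf0 : ∀ u ∈ Icc x X, 0 ≤ f u) (hfI : IntegrableOn f (Icc x X)) :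
    ∫ u in Icc x X, f u ≤ (∫ u in Icc x U, f u) + ∫ u in Icc U X, f u := by
  have hunion : Icc x U ∪ Ioc U X = Icc x X := Set.Icc_union_Ioc_eq_Icc hxU hUX
  have hdisj : Disjoint (Icc x U) (Ioc U X) := by
    rw [Set.disjoint_left]; intro u hu hu'; exact absurd hu'.1 (not_lt.2 hu.2)
  have h1 : IntegrableOn f (Icc x U) := hfI.mono_set (Icc_subset_Icc le_rfl hUX)
  have h2 : IntegrableOn f (Icc U X) := hfI.mono_set (Icc_subset_Icc hxU le_rfl)
  rw [← hunion, setIntegral_union hdisj measurableSet_Ioc h1 (h2.mono_set Ioc_subset_Icc_self)]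
  exact add_le_add_right (setIntegral_mono_set h2
    ((ae_restrict_iff' measurableSet_Icc).2 (ae_of_all _ fun u hu ↦ hf0 u ⟨hxU.trans hu.1, hu.2⟩))
    (Eventually.of_forall Ioc_subset_Icc_self)) _

/-- The initial constant `Init = 4 (9H)^{2σ'+1} C_{E1} φ² (log q+1)²/ε`. [folklore] -/
def Cinit (q : ℕ) (σ' ε H : ℝ) : ℝ :=
  4 * ((9 * H) ^ (2 * σ' + 1) * (CE1 * (q.totient : ℝ) ^ 2 * (Real.log q + 1) ^ 2 / ε))

omit [NeZero q] in
/-- `Cinit ≥ 0`. [folklore] -/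
theorem Cinit_nonneg (q : ℕ) {σ' ε H : ℝ} (hε : 0 < ε) (hH : 0 ≤ H) : 0 ≤ Cinit q σ' ε H := by
  have : 0 ≤ CE1 := by rw [CE1]; have := SegmentWeights.S₂_nonneg; positivity
  unfold Cinit; positivity

/-- **Initial range**: for `1 ≤ X ≤ 8H`, `∫_1^X (R_b(u+H) − R_b(u))² ≤ Init`. [folklore] -/
theorem setIntegral_addShift_sq_le_init {b : ZMod q} (hb : IsUnit b) {σ₁ : ℝ} (hσ₁ : 1 / 2 ≤ σ₁)
    (hZ : ZerosRealPartLE q σ₁) {ε : ℝ} (hε : 0 < ε) (hσ'1 : σ₁ + ε < 1) {H : ℕ} (hH : 1 ≤ H)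
    {X : ℝ} (hX1 : 1 ≤ X) (hX : X ≤ 8 * H) :
    ∫ u in Icc 1 X, (Rrem b (u + H) - Rrem b u) ^ 2 ≤ Cinit q (σ₁ + ε) ε H := by
  have hH1 : (1 : ℝ) ≤ H := by exact_mod_cast hH
  have h9H : (1 : ℝ) ≤ 9 * H := by linarith
  have hmain := setIntegral_Rrem_sq_le_pow hb hσ₁ hZ hε hσ'1 h9H
  have hI9 := integrableOn_Rrem_sq b 1 (9 * H)
  have hnn : ∀ᵐ u ∂(volume.restrict (Icc (1 : ℝ) (9 * H))), 0 ≤ Rrem b u ^ 2 :=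
    (ae_restrict_iff' measurableSet_Icc).2 (ae_of_all _ fun u _ ↦ sq_nonneg _)
  -- the two pieces
  have h1 : ∫ u in Icc 1 X, Rrem b (u + H) ^ 2 ≤ ∫ u in Icc (1 : ℝ) (9 * (H : ℝ)), Rrem b u ^ 2 := by
    rw [Literature.Analysis.FunctionSpaces.SaffariVaughan.setIntegral_Icc_comp_add (fun u ↦ Rrem b u ^ 2) 1 X H]
    exact setIntegral_mono_set hI9 hnn (Eventually.of_forall (Icc_subset_Icc (by linarith) (by linarith)))
  have h2 : ∫ u in Icc 1 X, Rrem b u ^ 2 ≤ ∫ u in Icc (1 : ℝ) (9 * (H : ℝ)), Rrem b u ^ 2 :=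
    setIntegral_mono_set hI9 hnn (Eventually.of_forall (Icc_subset_Icc le_rfl (by linarith)))
  have hIs : IntegrableOn (fun u ↦ Rrem b (u + H) ^ 2) (Icc 1 X) := by
    refine integrableOn_Icc_of_bound (((measurable_Rrem b).comp (measurable_id.add_const (H : ℝ))).pow_const 2)
      (M := (ClassicalPsiData.psi (Lam b) (X + H) + (X + H)) ^ 2) fun u hu ↦ ?_
    show |Rrem b (u + H) ^ 2| ≤ (ClassicalPsiData.psi (Lam b) (X + H) + (X + H)) ^ 2
    rw [abs_of_nonneg (sq_nonneg _)]
    have h := abs_Rrem_le' b (Z := X + H) (by linarith) (show u + H ≤ X + H by linarith [hu.2])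
    have := sq_abs (Rrem b (u + H))
    nlinarith [abs_nonneg (Rrem b (u + H))]
  have hIr : IntegrableOn (fun u ↦ Rrem b u ^ 2) (Icc 1 X) := integrableOn_Rrem_sq b 1 X
  have hpt : ∀ u ∈ Icc (1 : ℝ) X, (Rrem b (u + H) - Rrem b u) ^ 2 ≤ 2 * Rrem b (u + H) ^ 2 + 2 * Rrem b u ^ 2 := by
    intro u _; nlinarith [sq_nonneg (Rrem b (u + H) + Rrem b u)]
  have hIsum : IntegrableOn (fun u ↦ 2 * Rrem b (u + H) ^ 2 + 2 * Rrem b u ^ 2) (Icc 1 X) :=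
    (hIs.const_mul 2).add (hIr.const_mul 2)
  calc ∫ u in Icc 1 X, (Rrem b (u + H) - Rrem b u) ^ 2
      ≤ ∫ u in Icc 1 X, (2 * Rrem b (u + H) ^ 2 + 2 * Rrem b u ^ 2) :=
        setIntegral_mono_on (integrableOn_addShift_sq b H 1 X) hIsum measurableSet_Icc hpt
    _ = 2 * (∫ u in Icc 1 X, Rrem b (u + H) ^ 2) + 2 * ∫ u in Icc 1 X, Rrem b u ^ 2 := by
        rw [integral_add (hIs.const_mul 2) (hIr.const_mul 2), MeasureTheory.integral_const_mul,
          MeasureTheory.integral_const_mul]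
    _ ≤ 2 * (∫ u in Icc (1 : ℝ) (9 * (H : ℝ)), Rrem b u ^ 2) + 2 * ∫ u in Icc (1 : ℝ) (9 * (H : ℝ)), Rrem b u ^ 2 := by gcongr
    _ = 4 * ∫ u in Icc (1 : ℝ) (9 * (H : ℝ)), Rrem b u ^ 2 := by ring
    _ ≤ Cinit q (σ₁ + ε) ε H := by
        rw [Cinit]
        refine mul_le_mul_of_nonneg_left ?_ (by norm_num)
        convert hmain using 2

/-- **Dyadic induction**: for `1 ≤ X ≤ X₀`,
`∫_1^X (R_b(u+H) − R_b(u))² ≤ Init + 2 C_blk X^{2σ'}` (proved for `X ≤ 8H 2^k` by induction on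
`k`, halving the interval and using the block bound on `[X/2, X]`). [folklore] -/
theorem setIntegral_addShift_sq_le_dyadic {b : ZMod q} (hb : IsUnit b) {σ₁ : ℝ} (hσ₁ : 1 / 2 ≤ σ₁)
    (hZ : ZerosRealPartLE q σ₁) {ε : ℝ} (hε : 0 < ε) (hσ'1 : σ₁ + ε < 1) {H : ℕ} (hH : 1 ≤ H)
    {X₀ : ℝ} (hX₀ : 1 ≤ X₀) (k : ℕ) :
    ∀ X : ℝ, 1 ≤ X → X ≤ X₀ → X ≤ 8 * H * 2 ^ k →
      ∫ u in Icc 1 X, (Rrem b (u + H) - Rrem b u) ^ 2 ≤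
        Cinit q (σ₁ + ε) ε H + 2 * Cblk q ε H X₀ * X ^ (2 * (σ₁ + ε)) := by
  have hH1 : (1 : ℝ) ≤ H := by exact_mod_cast hH
  have hCb : 0 ≤ Cblk q ε H X₀ := Cblk_nonneg q hε (by linarith) (by linarith)
  have hCi : 0 ≤ Cinit q (σ₁ + ε) ε H := Cinit_nonneg q hε (by linarith)
  induction k with
  | zero =>
      intro X hX1 _ hXk
      rw [pow_zero, mul_one] at hXk
      have h := setIntegral_addShift_sq_le_init hb hσ₁ hZ hε hσ'1 hH hX1 hXk
      have : 0 ≤ 2 * Cblk q ε H X₀ * X ^ (2 * (σ₁ + ε)) := by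
        have := Real.rpow_nonneg (show (0 : ℝ) ≤ X by linarith) (2 * (σ₁ + ε)); positivity
      linarith
  | succ k ih =>
      intro X hX1 hXX₀ hXk
      by_cases hc : X ≤ 8 * H * 2 ^ k
      · exact ih X hX1 hXX₀ hc
      · rw [not_le] at hc
        set U : ℝ := X / 2 with hU
        have h2k : (1 : ℝ) ≤ 2 ^ k := one_le_pow₀ (by norm_num)
        have hU4 : 4 * (H : ℝ) ≤ U := by
          rw [hU, le_div_iff₀ (by norm_num)]
          nlinarith
        have hU1 : 1 ≤ U := by linarith
        have hUX₀ : U ≤ X₀ := by rw [hU]; linarith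
        have hUk : U ≤ 8 * H * 2 ^ k := by rw [hU, div_le_iff₀ (by norm_num), pow_succ] at *; linarith
        have hUX : U ≤ X := by rw [hU]; linarith
        have hX2U : X = 2 * U := by rw [hU]; ring
        have hIH := ih U hU1 hUX₀ hUk
        have hblk := setIntegral_addShift_sq_le_block hb hσ₁ hZ hε hσ'1 hH hU4 hUX₀
        rw [← hX2U] at hblk
        have hsplit := setIntegral_Icc_split_le (f := fun u ↦ (Rrem b (u + H) - Rrem b u) ^ 2) hU1 hUX
          (fun u _ ↦ sq_nonneg _) (integrableOn_addShift_sq b H 1 X)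
        -- `U^{2σ'} ≤ X^{2σ'}/2`
        have hX0 : 0 < X := by linarith
        have hpow : U ^ (2 * (σ₁ + ε)) ≤ X ^ (2 * (σ₁ + ε)) / 2 := by
          rw [hU, Real.div_rpow hX0.le (by norm_num)]
          have h2 : (2 : ℝ) ^ (1 : ℝ) ≤ 2 ^ (2 * (σ₁ + ε)) :=
            Real.rpow_le_rpow_of_exponent_le (by norm_num) (by linarith)
          rw [Real.rpow_one] at h2
          rw [div_le_div_iff₀ (by positivity) (by norm_num)]
          have := Real.rpow_nonneg hX0.le (2 * (σ₁ + ε))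
          nlinarith
        have hXp : 0 ≤ X ^ (2 * (σ₁ + ε)) := Real.rpow_nonneg hX0.le _
        calc ∫ u in Icc 1 X, (Rrem b (u + H) - Rrem b u) ^ 2
            ≤ (∫ u in Icc 1 U, (Rrem b (u + H) - Rrem b u) ^ 2) + ∫ u in Icc U X, (Rrem b (u + H) - Rrem b u) ^ 2 :=
              hsplit
          _ ≤ (Cinit q (σ₁ + ε) ε H + 2 * Cblk q ε H X₀ * U ^ (2 * (σ₁ + ε))) +
                Cblk q ε H X₀ * U ^ (2 * (σ₁ + ε)) := add_le_add hIH hblk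
          _ = Cinit q (σ₁ + ε) ε H + 3 * Cblk q ε H X₀ * U ^ (2 * (σ₁ + ε)) := by ring
          _ ≤ Cinit q (σ₁ + ε) ε H + 3 * Cblk q ε H X₀ * (X ^ (2 * (σ₁ + ε)) / 2) := by gcongr
          _ ≤ Cinit q (σ₁ + ε) ε H + 2 * Cblk q ε H X₀ * X ^ (2 * (σ₁ + ε)) := by nlinarith [mul_nonneg hCb hXp]

/-- **The additive mean square on `[1, X₀]`** (`X₀ ≥ 1`, `H ≥ 1`):
`∫_1^{X₀} (R_b(u+H) − R_b(u))² ≤ Init + 2 C_blk X₀^{2σ'}`. [folklore] -/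
theorem setIntegral_addShift_sq_le_total {b : ZMod q} (hb : IsUnit b) {σ₁ : ℝ} (hσ₁ : 1 / 2 ≤ σ₁)
    (hZ : ZerosRealPartLE q σ₁) {ε : ℝ} (hε : 0 < ε) (hσ'1 : σ₁ + ε < 1) {H : ℕ} (hH : 1 ≤ H)
    {X₀ : ℝ} (hX₀ : 1 ≤ X₀) :
    ∫ u in Icc 1 X₀, (Rrem b (u + H) - Rrem b u) ^ 2 ≤
      Cinit q (σ₁ + ε) ε H + 2 * Cblk q ε H X₀ * X₀ ^ (2 * (σ₁ + ε)) := by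
  -- choose `k` with `X₀ ≤ 2^k`
  obtain ⟨k, hk⟩ : ∃ k : ℕ, X₀ ≤ 2 ^ k := by
    obtain ⟨k, hk⟩ := pow_unbounded_of_one_lt X₀ (by norm_num : (1 : ℝ) < 2)
    exact ⟨k, hk.le⟩
  have hH1 : (1 : ℝ) ≤ H := by exact_mod_cast hH
  refine setIntegral_addShift_sq_le_dyadic hb hσ₁ hZ hε hσ'1 hH hX₀ k X₀ hX₀ le_rfl ?_
  have : (2 : ℝ) ^ k ≤ 8 * H * 2 ^ k := by
    have := pow_nonneg (show (0 : ℝ) ≤ 2 by norm_num) k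
    nlinarith
  linarith

/-! ### Averaging `S₂` over short ranges -/

omit [NeZero q] in
/-- Upper average: `H S₂(N) ≤ ∑_{j<H} S₂(N + 1 + j)`. [folklore] -/
theorem mul_S2_le_sum (a b : ZMod q) (N H : ℕ) :
    (H : ℝ) * S2 a b N ≤ ∑ j ∈ range H, S2 a b (N + 1 + j) := by
  calc (H : ℝ) * S2 a b N = ∑ _j ∈ range H, S2 a b N := by rw [sum_const, card_range, nsmul_eq_mul]
    _ ≤ ∑ j ∈ range H, S2 a b (N + 1 + j) := sum_le_sum fun j _ ↦ S2_mono a b (by omega)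

omit [NeZero q] in
/-- Lower average: `∑_{j<H} S₂(N − H + j) ≤ H S₂(N)` (`H ≤ N`). [folklore] -/
theorem sum_S2_le_mul (a b : ZMod q) {N H : ℕ} (hHN : H ≤ N) :
    ∑ j ∈ range H, S2 a b (N - H - 1 + 1 + j) ≤ (H : ℝ) * S2 a b N := by
  calc ∑ j ∈ range H, S2 a b (N - H - 1 + 1 + j) ≤ ∑ _j ∈ range H, S2 a b N :=
        sum_le_sum fun j hj ↦ S2_mono a b (by rw [Finset.mem_range] at hj; omega)
    _ = (H : ℝ) * S2 a b N := by rw [sum_const, card_range, nsmul_eq_mul]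

omit [NeZero q] in
/-- The error term of one `S₂(M)`, `M ≥ 2`:
`S₂(M) − M²/2 = R₁,a(M−1) + R₁,b(M−1) + T₂(M) + (2 − 3M)/2`. [folklore] -/
theorem S2_sub_main_eq (a b : ZMod q) {M : ℕ} (hM : 2 ≤ M) :
    S2 a b M - (M : ℝ) ^ 2 / 2 =
      R1 a ((M : ℝ) - 1) + R1 b ((M : ℝ) - 1) + T2 a b M + (2 - 3 * (M : ℝ)) / 2 := by
  have hD := Dsum_eq b (M - 2)
  have hc : (((M - 2 + 1 : ℕ) : ℝ)) = (M : ℝ) - 1 := by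
    rw [show M - 2 + 1 = M - 1 by omega, Nat.cast_sub (by omega)]; norm_num
  rw [hc] at hD
  rw [S2_decomposition a b hM, hD, R1, R1, Nat.cast_sub hM]
  push_cast
  ring

omit [NeZero q] in
/-- Summing the error terms over `M = N + 1 + j`, `j < H`:
`∑_j (S₂(M_j) − M_j²/2) = ∑_j R₁,a(N+j) + ∑_j R₁,b(N+j) + BIL + ∑_j (2 − 3M_j)/2`. [folklore] -/
theorem sum_S2_sub_main_eq (a b : ZMod q) {N : ℕ} (hN : 1 ≤ N) (H : ℕ) :
    ∑ j ∈ range H, (S2 a b (N + 1 + j) - ((N + 1 + j : ℕ) : ℝ) ^ 2 / 2) =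
      ∑ j ∈ range H, R1 a ((N : ℝ) + j) + ∑ j ∈ range H, R1 b ((N : ℝ) + j) + BIL a b N H +
        ∑ j ∈ range H, (2 - 3 * ((N + 1 + j : ℕ) : ℝ)) / 2 := by
  rw [← sum_T2_eq_BIL, ← sum_add_distrib, ← sum_add_distrib, ← sum_add_distrib]
  refine sum_congr rfl fun j _ ↦ ?_
  rw [S2_sub_main_eq a b (by omega)]
  have : ((N + 1 + j : ℕ) : ℝ) - 1 = (N : ℝ) + j := by push_cast; ring
  rw [this]

omit [NeZero q] in
/-- The main-term bookkeeping of the upper average: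
`∑_{j<H} ((N+1+j)²/2 − N²/2) ≤ 2 N H²`... precisely `≤ H (2N H + ...)`; we use the crude
`∑_{j<H} ((N+1+j)² − N²)/2 ≤ H · (2 (N+H) H)`. [folklore] -/
theorem sum_sq_sub_sq_le (N H : ℕ) :
    ∑ j ∈ range H, (((N + 1 + j : ℕ) : ℝ) ^ 2 / 2 - (N : ℝ) ^ 2 / 2) ≤ (H : ℝ) * (2 * ((N : ℝ) + H) * H) := by
  have : ∀ j ∈ range H, ((N + 1 + j : ℕ) : ℝ) ^ 2 / 2 - (N : ℝ) ^ 2 / 2 ≤ 2 * ((N : ℝ) + H) * H := by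
    intro j hj
    rw [Finset.mem_range] at hj
    have hj' : (j : ℝ) + 1 ≤ H := by exact_mod_cast hj
    have hN0 : (0 : ℝ) ≤ N := Nat.cast_nonneg N
    have hj0 : (0 : ℝ) ≤ j := Nat.cast_nonneg j
    push_cast
    nlinarith
  calc ∑ j ∈ range H, (((N + 1 + j : ℕ) : ℝ) ^ 2 / 2 - (N : ℝ) ^ 2 / 2)
      ≤ ∑ _j ∈ range H, 2 * ((N : ℝ) + H) * H := sum_le_sum this
    _ = _ := by rw [sum_const, card_range, nsmul_eq_mul]

omit [NeZero q] in
/-- The main-term bookkeeping of the lower average (`N' = N − H − 1`):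
`∑_{j<H} (N²/2 − (N'+1+j)²/2) ≤ H (2 N (H + 1))`. [folklore] -/
theorem sum_sq_sub_sq_le' {N H : ℕ} (hHN : H + 1 ≤ N) :
    ∑ j ∈ range H, ((N : ℝ) ^ 2 / 2 - ((N - H - 1 + 1 + j : ℕ) : ℝ) ^ 2 / 2) ≤ (H : ℝ) * (2 * (N : ℝ) * (H + 1)) := by
  have : ∀ j ∈ range H, (N : ℝ) ^ 2 / 2 - ((N - H - 1 + 1 + j : ℕ) : ℝ) ^ 2 / 2 ≤ 2 * (N : ℝ) * (H + 1) := by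
    intro j hj
    rw [Finset.mem_range] at hj
    have e : ((N - H - 1 + 1 + j : ℕ) : ℝ) = (N : ℝ) - H + j := by
      rw [show N - H - 1 + 1 + j = N - H + j by omega]; push_cast [Nat.cast_sub (by omega : H ≤ N)]; ring
    rw [e]
    have hj0 : (0 : ℝ) ≤ j := Nat.cast_nonneg j
    have hjH : (j : ℝ) ≤ H := by exact_mod_cast hj.le
    have hHN' : (H : ℝ) + 1 ≤ N := by exact_mod_cast hHN
    nlinarith
  calc ∑ j ∈ range H, ((N : ℝ) ^ 2 / 2 - ((N - H - 1 + 1 + j : ℕ) : ℝ) ^ 2 / 2)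
      ≤ ∑ _j ∈ range H, 2 * (N : ℝ) * (H + 1) := sum_le_sum this
    _ = _ := by rw [sum_const, card_range, nsmul_eq_mul]

omit [NeZero q] in
/-- **Squeezing `S₂(N)` between its two averages**: for `1 ≤ H`, `H + 2 ≤ N`,
`|S₂(N) − N²/2| ≤ max(|E⁺|, |E⁻|)/H + 2N(H+1) + 2(N+H)H`, where `E^{±}` are the summed error
terms over `(N, N+H]` and `(N−H−1, N−1]`. [folklore] -/
theorem abs_S2_sub_le_of_averages (a b : ZMod q) {N H : ℕ} (hH : 1 ≤ H) (hHN : H + 2 ≤ N) :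
    |S2 a b N - (N : ℝ) ^ 2 / 2| ≤
      (|∑ j ∈ range H, (S2 a b (N + 1 + j) - ((N + 1 + j : ℕ) : ℝ) ^ 2 / 2)| +
        |∑ j ∈ range H, (S2 a b (N - H - 1 + 1 + j) - ((N - H - 1 + 1 + j : ℕ) : ℝ) ^ 2 / 2)|) / H +
      (2 * (N : ℝ) * (H + 1) + 2 * ((N : ℝ) + H) * H) := by
  have hH0 : (0 : ℝ) < H := by exact_mod_cast hH
  set Eu := ∑ j ∈ range H, (S2 a b (N + 1 + j) - ((N + 1 + j : ℕ) : ℝ) ^ 2 / 2) with hEu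
  set El := ∑ j ∈ range H, (S2 a b (N - H - 1 + 1 + j) - ((N - H - 1 + 1 + j : ℕ) : ℝ) ^ 2 / 2) with hEl
  -- upper
  have hup : (H : ℝ) * (S2 a b N - (N : ℝ) ^ 2 / 2) ≤ Eu + (H : ℝ) * (2 * ((N : ℝ) + H) * H) := by
    have h1 := mul_S2_le_sum a b N H
    have h2 := sum_sq_sub_sq_le N H
    have e : ∑ j ∈ range H, S2 a b (N + 1 + j) = Eu + ∑ j ∈ range H, ((N + 1 + j : ℕ) : ℝ) ^ 2 / 2 := by
      rw [hEu, ← sum_add_distrib]; exact sum_congr rfl fun j _ ↦ by ring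
    have e2 : ∑ j ∈ range H, (((N + 1 + j : ℕ) : ℝ) ^ 2 / 2 - (N : ℝ) ^ 2 / 2) =
        ∑ j ∈ range H, ((N + 1 + j : ℕ) : ℝ) ^ 2 / 2 - (H : ℝ) * ((N : ℝ) ^ 2 / 2) := by
      rw [sum_sub_distrib, sum_const, card_range, nsmul_eq_mul]
    rw [e2] at h2
    nlinarith
  -- lower
  have hlo : El - (H : ℝ) * (2 * (N : ℝ) * (H + 1)) ≤ (H : ℝ) * (S2 a b N - (N : ℝ) ^ 2 / 2) := by
    have h1 := sum_S2_le_mul a b (show H ≤ N by omega)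
    have h2 := sum_sq_sub_sq_le' (show H + 1 ≤ N by omega)
    have e : ∑ j ∈ range H, S2 a b (N - H - 1 + 1 + j) = El + ∑ j ∈ range H, ((N - H - 1 + 1 + j : ℕ) : ℝ) ^ 2 / 2 := by
      rw [hEl, ← sum_add_distrib]; exact sum_congr rfl fun j _ ↦ by ring
    have e2 : ∑ j ∈ range H, ((N : ℝ) ^ 2 / 2 - ((N - H - 1 + 1 + j : ℕ) : ℝ) ^ 2 / 2) =
        (H : ℝ) * ((N : ℝ) ^ 2 / 2) - ∑ j ∈ range H, ((N - H - 1 + 1 + j : ℕ) : ℝ) ^ 2 / 2 := by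
      rw [sum_sub_distrib, sum_const, card_range, nsmul_eq_mul]
    rw [e2] at h2
    nlinarith
  rw [abs_le]
  constructor
  · rw [add_div, neg_add]
    have h1 : -(|El| / H) ≤ El / H := by
      rw [← neg_div]; exact div_le_div_of_nonneg_right (neg_abs_le El) hH0.le
    have h2 : 0 ≤ |Eu| / H := by positivity
    have h3 : El / H - 2 * (N : ℝ) * (H + 1) ≤ S2 a b N - (N : ℝ) ^ 2 / 2 := by
      rw [div_sub' (hc := hH0.ne'), div_le_iff₀ hH0]; nlinarith
    nlinarith [h1, h2, h3, show (0:ℝ) ≤ 2 * ((N : ℝ) + H) * H by positivity]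
  · have h1 : Eu / H ≤ |Eu| / H := div_le_div_of_nonneg_right (le_abs_self Eu) hH0.le
    have h2 : 0 ≤ |El| / H := by positivity
    have h3 : S2 a b N - (N : ℝ) ^ 2 / 2 ≤ Eu / H + 2 * ((N : ℝ) + H) * H := by
      rw [div_add' (hc := hH0.ne'), le_div_iff₀ hH0]; nlinarith
    rw [add_div]
    nlinarith [h1, h2, h3, show (0:ℝ) ≤ 2 * (N : ℝ) * (H + 1) by positivity]

/-! ### Parameters: `ε = 2/log N`, `H = ⌊N^{σ₁}⌋` -/

omit [NeZero q] in
/-- `N^{2/log N} = e²` (`N > 1`). [folklore] -/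
theorem rpow_two_div_log {n : ℝ} (hn : 1 < n) : n ^ (2 / Real.log n) = Real.exp 2 := by
  have hlog : 0 < Real.log n := Real.log_pos hn
  rw [Real.rpow_def_of_pos (by linarith), show Real.log n * (2 / Real.log n) = 2 by field_simp]

omit [NeZero q] in
/-- `N^{c/log N·...}`: `N^{t ε} = e^{2t}` for `ε = 2/log N`. [folklore] -/
theorem rpow_mul_two_div_log {n : ℝ} (hn : 1 < n) (t : ℝ) : n ^ (t * (2 / Real.log n)) = Real.exp (2 * t) := by
  have hlog : 0 < Real.log n := Real.log_pos hn
  rw [Real.rpow_def_of_pos (by linarith), show Real.log n * (t * (2 / Real.log n)) = 2 * t by field_simp]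

omit [NeZero q] in
/-- For `1 ≤ y ≤ 2N` and `ε = 2/log N` (`N ≥ 2`): `y^{2(σ₁+ε)+1} ≤ 8 e⁸ N^{2σ₁+1}` (`σ₁ ≤ 1`). [folklore] -/
theorem rpow_p_le {n y σ₁ : ℝ} (hn : 2 ≤ n) (hy1 : 1 ≤ y) (hy : y ≤ 2 * n) (hσ₁0 : 0 ≤ σ₁) (hσ₁ : σ₁ ≤ 1) :
    y ^ (2 * (σ₁ + 2 / Real.log n) + 1) ≤ 8 * Real.exp 8 * n ^ (2 * σ₁ + 1) := by
  have hn1 : 1 < n := by linarith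
  have hn0 : 0 < n := by linarith
  have hε0 : 0 < 2 / Real.log n := div_pos two_pos (Real.log_pos hn1)
  have h2n : y ≤ n ^ 2 := hy.trans (by nlinarith)
  have hsplit : y ^ (2 * (σ₁ + 2 / Real.log n) + 1) = y ^ (2 * σ₁ + 1) * y ^ (2 * (2 / Real.log n)) := by
    rw [← Real.rpow_add (by linarith)]; ring_nf
  rw [hsplit]
  have h1 : y ^ (2 * σ₁ + 1) ≤ (2 * n) ^ (2 * σ₁ + 1) := Real.rpow_le_rpow (by linarith) hy (by linarith)
  have h2 : (2 * n) ^ (2 * σ₁ + 1) = 2 ^ (2 * σ₁ + 1) * n ^ (2 * σ₁ + 1) := Real.mul_rpow (by norm_num) hn0.le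
  have h3 : (2 : ℝ) ^ (2 * σ₁ + 1) ≤ 2 ^ (3 : ℝ) := Real.rpow_le_rpow_of_exponent_le (by norm_num) (by linarith)
  have h4 : y ^ (2 * (2 / Real.log n)) ≤ (n ^ 2) ^ (2 * (2 / Real.log n)) :=
    Real.rpow_le_rpow (by linarith) h2n (mul_nonneg (by norm_num) hε0.le)
  have h5 : (n ^ 2) ^ (2 * (2 / Real.log n)) = Real.exp 8 := by
    rw [← Real.rpow_natCast n 2, ← Real.rpow_mul hn0.le, show ((2 : ℕ) : ℝ) * (2 * (2 / Real.log n)) = 4 * (2 / Real.log n) by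
      push_cast; ring, rpow_mul_two_div_log hn1]; norm_num
  have hnp : 0 ≤ n ^ (2 * σ₁ + 1) := Real.rpow_nonneg hn0.le _
  calc y ^ (2 * σ₁ + 1) * y ^ (2 * (2 / Real.log n))
      ≤ (2 ^ (3 : ℝ) * n ^ (2 * σ₁ + 1)) * Real.exp 8 := by
        refine mul_le_mul (h1.trans (by rw [h2]; gcongr)) (h4.trans h5.le) (Real.rpow_nonneg (by linarith) _)
          (by positivity)
    _ = 8 * Real.exp 8 * n ^ (2 * σ₁ + 1) := by norm_num; ring

omit [NeZero q] in
/-- For `0 ≤ y ≤ 2N`: `y^{2(σ₁+ε)} ≤ 4 e⁸ N^{2σ₁}` (`ε = 2/log N`, `N ≥ 2`, `0 ≤ σ₁ ≤ 1`). [folklore] -/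
theorem rpow_two_sigma_le {n y σ₁ : ℝ} (hn : 2 ≤ n) (hy0 : 1 ≤ y) (hy : y ≤ 2 * n) (hσ₁0 : 0 ≤ σ₁) (hσ₁ : σ₁ ≤ 1) :
    y ^ (2 * (σ₁ + 2 / Real.log n)) ≤ 4 * Real.exp 8 * n ^ (2 * σ₁) := by
  have hn1 : 1 < n := by linarith
  have hn0 : 0 < n := by linarith
  have hε0 : 0 < 2 / Real.log n := div_pos two_pos (Real.log_pos hn1)
  have h2n : y ≤ n ^ 2 := hy.trans (by nlinarith)
  have hsplit : y ^ (2 * (σ₁ + 2 / Real.log n)) = y ^ (2 * σ₁) * y ^ (2 * (2 / Real.log n)) := by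
    rw [← Real.rpow_add (by linarith)]; ring_nf
  rw [hsplit]
  have h1 : y ^ (2 * σ₁) ≤ (2 * n) ^ (2 * σ₁) := Real.rpow_le_rpow (by linarith) hy (by linarith)
  have h2 : (2 * n) ^ (2 * σ₁) = 2 ^ (2 * σ₁) * n ^ (2 * σ₁) := Real.mul_rpow (by norm_num) hn0.le
  have h3 : (2 : ℝ) ^ (2 * σ₁) ≤ 2 ^ (2 : ℝ) := Real.rpow_le_rpow_of_exponent_le (by norm_num) (by linarith)
  have h4 : y ^ (2 * (2 / Real.log n)) ≤ (n ^ 2) ^ (2 * (2 / Real.log n)) :=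
    Real.rpow_le_rpow (by linarith) h2n (mul_nonneg (by norm_num) hε0.le)
  have h5 : (n ^ 2) ^ (2 * (2 / Real.log n)) = Real.exp 8 := by
    rw [← Real.rpow_natCast n 2, ← Real.rpow_mul hn0.le, show ((2 : ℕ) : ℝ) * (2 * (2 / Real.log n)) = 4 * (2 / Real.log n) by
      push_cast; ring, rpow_mul_two_div_log hn1]; norm_num
  have hnp : 0 ≤ n ^ (2 * σ₁) := Real.rpow_nonneg hn0.le _
  calc y ^ (2 * σ₁) * y ^ (2 * (2 / Real.log n))
      ≤ (2 ^ (2 : ℝ) * n ^ (2 * σ₁)) * Real.exp 8 := by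
        refine mul_le_mul (h1.trans (by rw [h2]; gcongr)) (h4.trans h5.le) (Real.rpow_nonneg (by linarith) _)
          (by positivity)
    _ = 4 * Real.exp 8 * n ^ (2 * σ₁) := by norm_num; ring

omit [NeZero q] in
/-- The shift length `H = ⌊N^{σ₁}⌋`: `N^{σ₁}/2 ≤ H ≤ N^{σ₁}`, `4 ≤ H`, and `H ≤ N/54` when
`σ₁ + 4/log N ≤ 1`, `N ≥ 16`, `σ₁ ≥ 1/2`. [folklore] -/
theorem floor_rpow_facts {n σ₁ : ℝ} (hn : 16 ≤ n) (hσ₁ : 1 / 2 ≤ σ₁) (hσn : σ₁ + 4 / Real.log n ≤ 1) :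
    (⌊n ^ σ₁⌋₊ : ℝ) ≤ n ^ σ₁ ∧ n ^ σ₁ / 2 ≤ ⌊n ^ σ₁⌋₊ ∧ (4 : ℝ) ≤ ⌊n ^ σ₁⌋₊ ∧
      (⌊n ^ σ₁⌋₊ : ℝ) ≤ n / Real.exp 4 ∧ n ^ (2 * σ₁) ≤ n ^ 2 / Real.exp 8 := by
  have hn0 : 0 < n := by linarith
  have hn1 : 1 < n := by linarith
  have hlog : 0 < Real.log n := Real.log_pos hn1
  have hns0 : 0 ≤ n ^ σ₁ := Real.rpow_nonneg hn0.le _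
  have h4 : (4 : ℝ) ≤ n ^ σ₁ := by
    calc (4 : ℝ) = 16 ^ (1 / 2 : ℝ) := by
          rw [show (16 : ℝ) = 4 ^ ((2 : ℕ) : ℝ) by norm_num, ← Real.rpow_mul (by norm_num)]; norm_num
      _ ≤ n ^ (1 / 2 : ℝ) := Real.rpow_le_rpow (by norm_num) hn (by norm_num)
      _ ≤ n ^ σ₁ := Real.rpow_le_rpow_of_exponent_le hn1.le hσ₁
  have hfl := Nat.floor_le hns0
  have hlt := Nat.lt_floor_add_one (n ^ σ₁)
  refine ⟨hfl, by linarith, ?_, ?_, ?_⟩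
  · have : (3 : ℝ) < ⌊n ^ σ₁⌋₊ := by linarith
    have : 3 < ⌊n ^ σ₁⌋₊ := by exact_mod_cast this
    exact_mod_cast (show 4 ≤ ⌊n ^ σ₁⌋₊ by omega)
  · -- `n^{σ₁} ≤ n^{1 − 4/log n} = n e^{-4}`
    have h1 : n ^ σ₁ ≤ n ^ (1 - 4 / Real.log n) := Real.rpow_le_rpow_of_exponent_le hn1.le (by linarith)
    have h2 : n ^ (1 - 4 / Real.log n) = n / Real.exp 4 := by
      rw [Real.rpow_sub hn0, Real.rpow_one, show (4 : ℝ) / Real.log n = 2 * (2 / Real.log n) by ring,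
        rpow_mul_two_div_log hn1]
      norm_num
    linarith
  · have h8 : (8 : ℝ) / Real.log n = 2 * (4 / Real.log n) := by ring
    have h1 : n ^ (2 * σ₁) ≤ n ^ (2 - 8 / Real.log n) := Real.rpow_le_rpow_of_exponent_le hn1.le (by linarith)
    have h2 : n ^ (2 - 8 / Real.log n) = n ^ 2 / Real.exp 8 := by
      rw [Real.rpow_sub hn0, Real.rpow_two, show (8 : ℝ) / Real.log n = 4 * (2 / Real.log n) by ring,
        rpow_mul_two_div_log hn1]
      norm_num
    linarith

/-! ### The bound for `BIL` -/

/-- `K_A = 16 e⁸ C_{E1} + 4`. [folklore] -/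
def KA : ℝ := 16 * Real.exp 8 * CE1 + 4

/-- `K_B = 160 e⁸ C_{E1} + 140000 e⁸ C_{E2} + 2`. [folklore] -/
def KB : ℝ := 160 * Real.exp 8 * CE1 + 140000 * Real.exp 8 * CE2 + 2

omit [NeZero q] in
/-- `0 ≤ C_{E1}`. [folklore] -/
theorem CE1_nonneg : 0 ≤ CE1 := by rw [CE1]; have := SegmentWeights.S₂_nonneg; positivity

omit [NeZero q] in
/-- `0 ≤ C_{E2}`. [folklore] -/
theorem CE2_nonneg : 0 ≤ CE2 := by rw [CE2]; positivity

/-- **First factor**: `∑_{l<N''+H} R_a(l)² ≤ K_A φ² (log q+1)² (log N+1) N^{2σ₁+1}`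
(`N'' + H ≤ 2N`, `N ≥ 16`, `σ₁ + 4/log N ≤ 1`). [folklore] -/
theorem sum_Rrem_sq_le_KA {a : ZMod q} (ha : IsUnit a) {σ₁ : ℝ} (hσ₁ : 1 / 2 ≤ σ₁)
    (hZ : ZerosRealPartLE q σ₁) {N L : ℕ} (hN : 16 ≤ N) (hσN : σ₁ + 4 / Real.log N ≤ 1)
    (hL1 : 1 ≤ L) (hL : L ≤ 2 * N) :
    ∑ l ∈ range L, Rrem a l ^ 2 ≤
      KA * (q.totient : ℝ) ^ 2 * (Real.log q + 1) ^ 2 * (Real.log N + 1) * (N : ℝ) ^ (2 * σ₁ + 1) := by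
  have hn : (16 : ℝ) ≤ N := by exact_mod_cast hN
  have hn1 : (1 : ℝ) < N := by linarith
  have hlog : 0 < Real.log N := Real.log_pos hn1
  have hlog1 : 2 ≤ Real.log N := by
    have : Real.log 16 ≤ Real.log N := Real.log_le_log (by norm_num) hn
    have h16 : (2 : ℝ) ≤ Real.log 16 := by
      rw [← Real.log_exp 2]
      refine Real.log_le_log (Real.exp_pos 2) ?_
      have := Real.exp_one_lt_d9
      have : Real.exp 2 = Real.exp 1 * Real.exp 1 := by rw [← Real.exp_add]; norm_num
      nlinarith [Real.exp_pos 1]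
    linarith
  set ε : ℝ := 2 / Real.log N with hε
  have hε0 : 0 < ε := by positivity
  have hσ'1 : σ₁ + ε < 1 := by
    have : ε ≤ 4 / Real.log N / 2 := by rw [hε]; ring_nf; rfl
    have h4 : 0 < 4 / Real.log N := by positivity
    linarith
  have hL1r : (1 : ℝ) ≤ L := by exact_mod_cast hL1
  have hLr : (L : ℝ) ≤ 2 * N := by exact_mod_cast hL
  have h1 := sum_range_Rrem_sq_le a hL1
  have h2 := setIntegral_Rrem_sq_le_pow ha hσ₁ hZ hε0 hσ'1 hL1r
  have h3 := rpow_p_le (σ₁ := σ₁) (y := (L : ℝ)) (by linarith) hL1r hLr (by linarith) (by linarith)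
  rw [← hε] at h3
  have hφ1 : (1 : ℝ) ≤ q.totient := by exact_mod_cast Nat.totient_pos.2 (NeZero.pos q)
  have hLq1 : (1 : ℝ) ≤ (Real.log q + 1) ^ 2 := by
    have := Real.log_natCast_nonneg q; nlinarith
  have hCE1 := CE1_nonneg
  have hnp : (N : ℝ) ≤ (N : ℝ) ^ (2 * σ₁ + 1) := by
    calc (N : ℝ) = (N : ℝ) ^ (1 : ℝ) := (Real.rpow_one _).symm
      _ ≤ (N : ℝ) ^ (2 * σ₁ + 1) := Real.rpow_le_rpow_of_exponent_le hn1.le (by linarith)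
  have hnp0 : 0 ≤ (N : ℝ) ^ (2 * σ₁ + 1) := Real.rpow_nonneg (by linarith) _
  -- `1/ε = log N / 2 ≤ log N + 1`
  have hinv : CE1 * (q.totient : ℝ) ^ 2 * (Real.log q + 1) ^ 2 / ε ≤
      CE1 * (q.totient : ℝ) ^ 2 * (Real.log q + 1) ^ 2 * (Real.log N + 1) := by
    rw [hε, div_div_eq_mul_div, div_le_iff₀ (by norm_num : (0:ℝ) < 2)]
    have : 0 ≤ CE1 * (q.totient : ℝ) ^ 2 * (Real.log q + 1) ^ 2 := by positivity
    nlinarith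
  calc ∑ l ∈ range L, Rrem a l ^ 2 ≤ 2 * (∫ u in Icc (1 : ℝ) (L : ℝ), Rrem a u ^ 2) + 2 * L := h1
    _ ≤ 2 * ((L : ℝ) ^ (2 * (σ₁ + ε) + 1) * (CE1 * (q.totient : ℝ) ^ 2 * (Real.log q + 1) ^ 2 / ε)) + 2 * (2 * N) := by
        gcongr
    _ ≤ 2 * ((8 * Real.exp 8 * (N : ℝ) ^ (2 * σ₁ + 1)) *
          (CE1 * (q.totient : ℝ) ^ 2 * (Real.log q + 1) ^ 2 * (Real.log N + 1))) + 4 * (N : ℝ) ^ (2 * σ₁ + 1) := by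
        have h0 : 0 ≤ CE1 * (q.totient : ℝ) ^ 2 * (Real.log q + 1) ^ 2 / ε := by positivity
        nlinarith [mul_le_mul h3 hinv h0 (by positivity)]
    _ ≤ KA * (q.totient : ℝ) ^ 2 * (Real.log q + 1) ^ 2 * (Real.log N + 1) * (N : ℝ) ^ (2 * σ₁ + 1) := by
        rw [KA]
        have e1 : 4 * (N : ℝ) ^ (2 * σ₁ + 1) ≤ 4 * ((q.totient : ℝ) ^ 2 * (Real.log q + 1) ^ 2 * (Real.log N + 1)) *
            (N : ℝ) ^ (2 * σ₁ + 1) := by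
          refine mul_le_mul_of_nonneg_right ?_ hnp0
          have : (1 : ℝ) ≤ (q.totient : ℝ) ^ 2 * (Real.log q + 1) ^ 2 * (Real.log N + 1) := by
            have h1' : (1:ℝ) ≤ (q.totient : ℝ) ^ 2 := by nlinarith
            calc (1 : ℝ) = 1 * 1 * 1 := by ring
              _ ≤ (q.totient : ℝ) ^ 2 * (Real.log q + 1) ^ 2 * (Real.log N + 1) :=
                  mul_le_mul (mul_le_mul h1' hLq1 zero_le_one (by positivity)) (by linarith) zero_le_one (by positivity)
          linarith
        nlinarith [e1]

/-- Common numerical facts for `N ≥ 16`, `σ₁ ≥ 1/2`, `σ₁ + 4/log N ≤ 1`, `ε = 2/log N`. [folklore] -/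
theorem basic_facts {N : ℕ} {σ₁ : ℝ} (hN : 16 ≤ N) (hσ₁ : 1 / 2 ≤ σ₁) (hσN : σ₁ + 4 / Real.log N ≤ 1) :
    (16 : ℝ) ≤ N ∧ 2 ≤ Real.log N ∧ 0 < 2 / Real.log N ∧ σ₁ + 2 / Real.log N < 1 ∧ σ₁ ≤ 1 ∧
      1 / (2 / Real.log N) ≤ Real.log N + 1 := by
  have hn : (16 : ℝ) ≤ N := by exact_mod_cast hN
  have hn1 : (1 : ℝ) < N := by linarith
  have hlog : 0 < Real.log N := Real.log_pos hn1
  have hlog2 : 2 ≤ Real.log N := by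
    have : Real.log 16 ≤ Real.log N := Real.log_le_log (by norm_num) hn
    have h16 : (2 : ℝ) ≤ Real.log 16 := by
      rw [← Real.log_exp 2]
      refine Real.log_le_log (Real.exp_pos 2) ?_
      have := Real.exp_one_lt_d9
      have : Real.exp 2 = Real.exp 1 * Real.exp 1 := by rw [← Real.exp_add]; norm_num
      nlinarith [Real.exp_pos 1]
    linarith
  have h4 : 0 < 4 / Real.log N := by positivity
  refine ⟨hn, hlog2, by positivity, ?_, by linarith, ?_⟩
  · have : 2 / Real.log N = 4 / Real.log N / 2 := by ring
    linarith
  · rw [one_div_div]; rw [div_le_iff₀ (by norm_num : (0:ℝ) < 2)]; nlinarith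

set_option maxHeartbeats 4000000 in
/-- **Second factor**: with `H = ⌊N^{σ₁}⌋`, `N'' ≤ N`:
`∑_{l<N''+H} (R_b(N''+H−l) − R_b(N''−l))² ≤ K_B φ² (log q+1)² (log N+1)³ N^{2σ₁} H`. [folklore] -/
theorem sum_shift_sq_le_KB {b : ZMod q} (hb : IsUnit b) {σ₁ : ℝ} (hσ₁ : 1 / 2 ≤ σ₁)
    (hZ : ZerosRealPartLE q σ₁) {N N'' : ℕ} (hN : 16 ≤ N) (hσN : σ₁ + 4 / Real.log N ≤ 1)
    (hN'' : N'' ≤ N) :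
    ∑ l ∈ range (N'' + ⌊(N : ℝ) ^ σ₁⌋₊),
        (Rrem b ((N'' : ℝ) + ⌊(N : ℝ) ^ σ₁⌋₊ - l) - Rrem b ((N'' : ℝ) - l)) ^ 2 ≤
      KB * (q.totient : ℝ) ^ 2 * (Real.log q + 1) ^ 2 * (Real.log N + 1) ^ 3 * (N : ℝ) ^ (2 * σ₁) * ⌊(N : ℝ) ^ σ₁⌋₊ := by
  obtain ⟨hn, hlog2, hε0, hσ'1, hσ₁1, hinvε⟩ := basic_facts hN hσ₁ hσN
  obtain ⟨hHle, hHge, hH4, hHn, -⟩ := floor_rpow_facts hn hσ₁ hσN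
  set H : ℕ := ⌊(N : ℝ) ^ σ₁⌋₊ with hHdef
  set ε : ℝ := 2 / Real.log N with hε
  set Φ : ℝ := (q.totient : ℝ) with hΦ
  set Lq : ℝ := (Real.log q + 1) ^ 2 with hLq
  set LN : ℝ := Real.log N + 1 with hLN
  have hn0 : (0 : ℝ) < N := by linarith
  have hH1r : (1 : ℝ) ≤ H := by linarith
  have hH1 : 1 ≤ H := by exact_mod_cast hH1r
  have he4 : (54 : ℝ) ≤ Real.exp 4 := by
    have h27 : (2.7182818283 : ℝ) < Real.exp 1 := Real.exp_one_gt_d9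
    have h2 : Real.exp 4 = (Real.exp 1) ^ 4 := by rw [← Real.exp_nat_mul]; norm_num
    rw [h2]
    have := pow_le_pow_left₀ (by norm_num) h27.le 4
    exact le_trans (by norm_num) this
  have hHN : (H : ℝ) ≤ N / 54 := by
    refine hHn.trans ?_
    exact div_le_div_of_nonneg_left hn0.le (by norm_num) he4
  have hN''r : (N'' : ℝ) ≤ N := by exact_mod_cast hN''
  have hN''0 : (0 : ℝ) ≤ N'' := Nat.cast_nonneg _
  have hφ1 : (1 : ℝ) ≤ Φ := by
    rw [hΦ]; exact_mod_cast Nat.succ_le_of_lt (Nat.totient_pos.2 (NeZero.pos q))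
  have hLq1 : 1 ≤ Lq := by have := Real.log_natCast_nonneg q; rw [hLq]; nlinarith
  have hLN1 : 3 ≤ LN := by rw [hLN]; linarith
  have hCE1 := CE1_nonneg
  have hCE2 := CE2_nonneg
  have hNs : 0 ≤ (N : ℝ) ^ (2 * σ₁) := Real.rpow_nonneg hn0.le _
  have hNs1 : 1 ≤ (N : ℝ) ^ (2 * σ₁) := Real.one_le_rpow (by linarith) (by linarith)
  -- the pieces
  rw [sum_shift_sq_eq b N'' H]
  have hJ1 := sum_range_addShift_sq_le b N'' H
  have hJ2 := setIntegral_addShift_sq_le_total hb hσ₁ hZ hε0 hσ'1 hH1 (X₀ := (N'' : ℝ) + 1)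
    (by linarith)
  have hK1 := sum_range_Rrem_succ_sq_le b H
  have hK2 := setIntegral_Rrem_sq_le_pow hb hσ₁ hZ hε0 hσ'1 (X := (H : ℝ) + 1) (by linarith)
  -- power bounds
  have hX₀2N : (N'' : ℝ) + 1 ≤ 2 * N := by linarith
  have hpowX : ((N'' : ℝ) + 1) ^ (2 * (σ₁ + ε)) ≤ 4 * Real.exp 8 * (N : ℝ) ^ (2 * σ₁) :=
    rpow_two_sigma_le (by linarith) (by linarith) hX₀2N (by linarith) hσ₁1
  have hpow9H : (9 * (H : ℝ)) ^ (2 * (σ₁ + ε) + 1) ≤ 36 * Real.exp 8 * (N : ℝ) ^ (2 * σ₁) * H := by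
    have h1 : (9 * (H : ℝ)) ^ (2 * (σ₁ + ε)) ≤ 4 * Real.exp 8 * (N : ℝ) ^ (2 * σ₁) :=
      rpow_two_sigma_le (by linarith) (by linarith) (by linarith) (by linarith) hσ₁1
    rw [Real.rpow_add (by linarith), Real.rpow_one]
    nlinarith
  have hpowH1 : ((H : ℝ) + 1) ^ (2 * (σ₁ + ε) + 1) ≤ 8 * Real.exp 8 * (N : ℝ) ^ (2 * σ₁) * H := by
    have h1 : ((H : ℝ) + 1) ^ (2 * (σ₁ + ε)) ≤ 4 * Real.exp 8 * (N : ℝ) ^ (2 * σ₁) :=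
      rpow_two_sigma_le (by linarith) (by linarith) (by linarith) (by linarith) hσ₁1
    rw [Real.rpow_add (by linarith), Real.rpow_one]
    have : (H : ℝ) + 1 ≤ 2 * H := by linarith
    have h0 : 0 ≤ ((H : ℝ) + 1) ^ (2 * (σ₁ + ε)) := Real.rpow_nonneg (by linarith) _
    nlinarith [mul_le_mul h1 this (by linarith) (by positivity)]
  -- log bound for the block constant
  have hlogX : (1 + Real.log ((N'' : ℝ) + 1 + 1)) ^ 2 ≤ 4 * LN ^ 2 := by
    have hlog2le : Real.log 2 ≤ 1 := by
      have := Real.log_le_sub_one_of_pos (show (0:ℝ) < 2 by norm_num); linarith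
    have h1 : Real.log ((N'' : ℝ) + 1 + 1) ≤ Real.log N + 1 := by
      have h2N : (N'' : ℝ) + 1 + 1 ≤ 2 * N := by linarith
      calc Real.log ((N'' : ℝ) + 1 + 1) ≤ Real.log (2 * N) := Real.log_le_log (by linarith) h2N
        _ = Real.log 2 + Real.log N := Real.log_mul (by norm_num) hn0.ne'
        _ ≤ Real.log N + 1 := by linarith
    have h0 : 0 ≤ Real.log ((N'' : ℝ) + 1 + 1) := Real.log_nonneg (by linarith)
    have h2 : 1 + Real.log ((N'' : ℝ) + 1 + 1) ≤ 2 * LN := by rw [hLN]; linarith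
    calc (1 + Real.log ((N'' : ℝ) + 1 + 1)) ^ 2 ≤ (2 * LN) ^ 2 := pow_le_pow_left₀ (by linarith) h2 2
      _ = 4 * LN ^ 2 := by ring
  -- (i) Cinit
  have hCinit : Cinit q (σ₁ + ε) ε H ≤ 144 * Real.exp 8 * CE1 * Φ ^ 2 * Lq * LN * (N : ℝ) ^ (2 * σ₁) * H := by
    rw [Cinit]
    have e1 : CE1 * Φ ^ 2 * Lq / ε ≤ CE1 * Φ ^ 2 * Lq * LN := by
      rw [div_eq_mul_one_div]
      exact mul_le_mul_of_nonneg_left hinvε (by positivity)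
    have h0 : 0 ≤ CE1 * Φ ^ 2 * Lq / ε := by positivity
    calc 4 * ((9 * (H : ℝ)) ^ (2 * (σ₁ + ε) + 1) * (CE1 * Φ ^ 2 * Lq / ε))
        ≤ 4 * ((36 * Real.exp 8 * (N : ℝ) ^ (2 * σ₁) * H) * (CE1 * Φ ^ 2 * Lq * LN)) := by
          exact mul_le_mul_of_nonneg_left (mul_le_mul hpow9H e1 h0 (by positivity)) (by norm_num)
      _ = _ := by ring
  -- (ii) the block part
  have hblk : 2 * Cblk q ε H ((N'' : ℝ) + 1) * ((N'' : ℝ) + 1) ^ (2 * (σ₁ + ε)) ≤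
      138816 * Real.exp 8 * CE2 * Φ ^ 2 * Lq * LN ^ 3 * (N : ℝ) ^ (2 * σ₁) * H := by
    have hCb : Cblk q ε H ((N'' : ℝ) + 1) ≤ 8 * CE2 * Φ ^ 2 * (2169 * H * Lq * LN ^ 3) := by
      rw [Cblk]
      refine mul_le_mul_of_nonneg_left ?_ (by positivity)
      have e1 : 540 * (H : ℝ) * Lq * (1 + Real.log ((N'' : ℝ) + 1 + 1)) ^ 2 / ε ≤ 540 * H * Lq * (4 * LN ^ 2) * LN := by
        rw [div_eq_mul_one_div]
        exact mul_le_mul (mul_le_mul_of_nonneg_left hlogX (by positivity)) hinvε (by positivity) (by positivity)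
      have e2 : (9 : ℝ) ≤ 9 * H * Lq * LN ^ 3 := by
        have : (1 : ℝ) ≤ H * Lq * LN ^ 3 := by
          calc (1:ℝ) = 1 * 1 * 1 := by ring
            _ ≤ H * Lq * LN ^ 3 := mul_le_mul (mul_le_mul hH1r hLq1 zero_le_one (by linarith)) (by nlinarith) zero_le_one (by positivity)
        linarith
      nlinarith [e1, e2]
    have h0 : 0 ≤ Cblk q ε H ((N'' : ℝ) + 1) := Cblk_nonneg q hε0 (by linarith) (by linarith)
    calc 2 * Cblk q ε H ((N'' : ℝ) + 1) * ((N'' : ℝ) + 1) ^ (2 * (σ₁ + ε))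
        ≤ 2 * (8 * CE2 * Φ ^ 2 * (2169 * H * Lq * LN ^ 3)) * (4 * Real.exp 8 * (N : ℝ) ^ (2 * σ₁)) := by
          gcongr
      _ = _ := by ring
  -- (iii) the small-range mean square
  have hKint : 2 * (∫ u in Icc (1 : ℝ) ((H : ℝ) + 1), Rrem b u ^ 2) ≤ 16 * Real.exp 8 * CE1 * Φ ^ 2 * Lq * LN * (N : ℝ) ^ (2 * σ₁) * H := by
    have e1 : CE1 * Φ ^ 2 * Lq / ε ≤ CE1 * Φ ^ 2 * Lq * LN := by
      rw [div_eq_mul_one_div]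
      exact mul_le_mul_of_nonneg_left hinvε (by positivity)
    have h0 : 0 ≤ CE1 * Φ ^ 2 * Lq / ε := by positivity
    calc 2 * (∫ u in Icc (1 : ℝ) ((H : ℝ) + 1), Rrem b u ^ 2)
        ≤ 2 * (((H : ℝ) + 1) ^ (2 * (σ₁ + ε) + 1) * (CE1 * Φ ^ 2 * Lq / ε)) := by gcongr
      _ ≤ 2 * ((8 * Real.exp 8 * (N : ℝ) ^ (2 * σ₁) * H) * (CE1 * Φ ^ 2 * Lq * LN)) := by
          exact mul_le_mul_of_nonneg_left (mul_le_mul hpowH1 e1 h0 (by positivity)) (by norm_num)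
      _ = _ := by ring
  -- (iv) `2H`
  have h2H : 2 * (H : ℝ) ≤ 2 * Φ ^ 2 * Lq * LN ^ 3 * (N : ℝ) ^ (2 * σ₁) * H := by
    have : (1 : ℝ) ≤ Φ ^ 2 * Lq * LN ^ 3 * (N : ℝ) ^ (2 * σ₁) := by
      have h1 : (1:ℝ) ≤ Φ ^ 2 := by nlinarith
      calc (1:ℝ) = 1 * 1 * 1 * 1 := by ring
        _ ≤ Φ ^ 2 * Lq * LN ^ 3 * (N : ℝ) ^ (2 * σ₁) :=
            mul_le_mul (mul_le_mul (mul_le_mul h1 hLq1 zero_le_one (by positivity)) (by nlinarith) zero_le_one (by positivity))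
              hNs1 zero_le_one (by positivity)
    nlinarith
  -- assemble
  have hLN3 : LN ≤ LN ^ 3 := by nlinarith
  have hA : 0 ≤ Φ ^ 2 * Lq * (N : ℝ) ^ (2 * σ₁) * H := by positivity
  calc ∑ m ∈ range N'', (Rrem b ((m + 1 + H : ℕ) : ℝ) - Rrem b ((m + 1 : ℕ) : ℝ)) ^ 2 +
        ∑ k ∈ range H, Rrem b ((k + 1 : ℕ) : ℝ) ^ 2
      ≤ (Cinit q (σ₁ + ε) ε H + 2 * Cblk q ε H ((N'' : ℝ) + 1) * ((N'' : ℝ) + 1) ^ (2 * (σ₁ + ε))) +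
          (2 * (∫ u in Icc (1 : ℝ) ((H : ℝ) + 1), Rrem b u ^ 2) + 2 * H) := add_le_add (hJ1.trans hJ2) hK1
    _ ≤ (144 * Real.exp 8 * CE1 * Φ ^ 2 * Lq * LN * (N : ℝ) ^ (2 * σ₁) * H +
          138816 * Real.exp 8 * CE2 * Φ ^ 2 * Lq * LN ^ 3 * (N : ℝ) ^ (2 * σ₁) * H) +
          (16 * Real.exp 8 * CE1 * Φ ^ 2 * Lq * LN * (N : ℝ) ^ (2 * σ₁) * H +
            2 * Φ ^ 2 * Lq * LN ^ 3 * (N : ℝ) ^ (2 * σ₁) * H) := add_le_add (add_le_add hCinit hblk) (add_le_add hKint h2H)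
    _ ≤ KB * Φ ^ 2 * Lq * LN ^ 3 * (N : ℝ) ^ (2 * σ₁) * H := by
        rw [KB]
        have e1 : 144 * Real.exp 8 * CE1 * Φ ^ 2 * Lq * LN * (N : ℝ) ^ (2 * σ₁) * H ≤
            144 * Real.exp 8 * CE1 * Φ ^ 2 * Lq * LN ^ 3 * (N : ℝ) ^ (2 * σ₁) * H := by
          have : 0 ≤ 144 * Real.exp 8 * CE1 * (Φ ^ 2 * Lq * (N : ℝ) ^ (2 * σ₁) * H) := by positivity
          nlinarith [mul_le_mul_of_nonneg_left hLN3 this]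
        have e2 : 16 * Real.exp 8 * CE1 * Φ ^ 2 * Lq * LN * (N : ℝ) ^ (2 * σ₁) * H ≤
            16 * Real.exp 8 * CE1 * Φ ^ 2 * Lq * LN ^ 3 * (N : ℝ) ^ (2 * σ₁) * H := by
          have : 0 ≤ 16 * Real.exp 8 * CE1 * (Φ ^ 2 * Lq * (N : ℝ) ^ (2 * σ₁) * H) := by positivity
          nlinarith [mul_le_mul_of_nonneg_left hLN3 this]
        have e3 : 0 ≤ Real.exp 8 * CE2 * Φ ^ 2 * Lq * LN ^ 3 * (N : ℝ) ^ (2 * σ₁) * H := by positivity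
        nlinarith [e1, e2, e3]

set_option maxHeartbeats 4000000 in
/-- **The bilinear form**: with `H = ⌊N^{σ₁}⌋`, `N ≤ 2N''`, `N'' ≤ N`:
`|BIL(N'', H)| ≤ √(2 K_A K_B) φ² (log q+1)² (log N+1)² N^{1+σ₁} N^{-(1−σ₁)/2} H`. [folklore] -/
theorem abs_BIL_le {a b : ZMod q} (ha : IsUnit a) (hb : IsUnit b) {σ₁ : ℝ} (hσ₁ : 1 / 2 ≤ σ₁)
    (hZ : ZerosRealPartLE q σ₁) {N N'' : ℕ} (hN : 16 ≤ N) (hσN : σ₁ + 4 / Real.log N ≤ 1)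
    (hN''u : N'' ≤ N) (hN''1 : 1 ≤ N'') :
    |BIL a b N'' ⌊(N : ℝ) ^ σ₁⌋₊| ≤
      Real.sqrt (2 * KA * KB) * (q.totient : ℝ) ^ 2 * (Real.log q + 1) ^ 2 * (Real.log N + 1) ^ 2 *
        ((N : ℝ) ^ (1 + σ₁) * (N : ℝ) ^ (-((1 - σ₁) / 2))) * ⌊(N : ℝ) ^ σ₁⌋₊ := by
  obtain ⟨hn, hlog2, hε0, hσ'1, hσ₁1, hinvε⟩ := basic_facts hN hσ₁ hσN
  obtain ⟨hHle, hHge, hH4, hHn, -⟩ := floor_rpow_facts hn hσ₁ hσN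
  set H : ℕ := ⌊(N : ℝ) ^ σ₁⌋₊ with hHdef
  set Φ : ℝ := (q.totient : ℝ) with hΦ
  set Lq : ℝ := (Real.log q + 1) ^ 2 with hLq
  set LN : ℝ := Real.log N + 1 with hLN
  have hn0 : (0 : ℝ) < N := by linarith
  have he4 : (54 : ℝ) ≤ Real.exp 4 := by
    have h27 : (2.7182818283 : ℝ) < Real.exp 1 := Real.exp_one_gt_d9
    have h2 : Real.exp 4 = (Real.exp 1) ^ 4 := by rw [← Real.exp_nat_mul]; norm_num
    rw [h2]
    have := pow_le_pow_left₀ (by norm_num) h27.le 4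
    exact le_trans (by norm_num) this
  have hHN : (H : ℝ) ≤ N / 54 := hHn.trans (div_le_div_of_nonneg_left hn0.le (by norm_num) he4)
  have hL1 : 1 ≤ N'' + H := by omega
  have hL : N'' + H ≤ 2 * N := by
    have h1 : (H : ℝ) ≤ N := hHN.trans (div_le_self hn0.le (by norm_num))
    have h2 : H ≤ N := by exact_mod_cast h1
    omega
  have hF1 := sum_Rrem_sq_le_KA ha hσ₁ hZ hN hσN hL1 hL
  have hF2 := sum_shift_sq_le_KB hb hσ₁ hZ hN hσN hN''u
  have hCS := BIL_sq_le a b N'' H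
  have hKA : 0 ≤ KA := by rw [KA]; have := CE1_nonneg; positivity
  have hKB : 0 ≤ KB := by rw [KB]; have := CE1_nonneg; have := CE2_nonneg; positivity
  -- `BIL² ≤ A B`
  set A : ℝ := KA * Φ ^ 2 * Lq * LN * (N : ℝ) ^ (2 * σ₁ + 1) with hA
  set B : ℝ := KB * Φ ^ 2 * Lq * LN ^ 3 * (N : ℝ) ^ (2 * σ₁) * H with hB
  have hA0 : 0 ≤ A := by positivity
  have hF10 : 0 ≤ ∑ l ∈ range (N'' + H), Rrem a l ^ 2 := sum_nonneg fun l _ ↦ sq_nonneg _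
  have hsq : BIL a b N'' H ^ 2 ≤ A * B := by
    refine hCS.trans ?_
    have hcast : ∀ l : ℕ, Rrem b ((N'' : ℝ) + H - l) = Rrem b (((N'' : ℝ)) + (H : ℕ) - l) := fun l ↦ rfl
    exact mul_le_mul hF1 hF2 (sum_nonneg fun l _ ↦ sq_nonneg _) hA0
  -- `A B ≤ T²`
  set P : ℝ := (N : ℝ) ^ (1 + σ₁) * (N : ℝ) ^ (-((1 - σ₁) / 2)) with hP
  have hP2 : P ^ 2 = (N : ℝ) ^ (1 + 3 * σ₁) := by
    rw [hP, ← Real.rpow_add hn0, ← Real.rpow_natCast, ← Real.rpow_mul hn0.le]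
    congr 1; push_cast; ring
  have hNsplit : (N : ℝ) ^ (2 * σ₁ + 1) * (N : ℝ) ^ (2 * σ₁) = (N : ℝ) ^ (1 + 3 * σ₁) * (N : ℝ) ^ σ₁ := by
    rw [← Real.rpow_add hn0, ← Real.rpow_add hn0]; congr 1; ring
  have hNσH : (N : ℝ) ^ σ₁ ≤ 2 * H := by linarith
  set T : ℝ := Real.sqrt (2 * KA * KB) * Φ ^ 2 * Lq * LN ^ 2 * P * H with hT
  have hT0 : 0 ≤ T := by positivity
  have hT2 : A * B ≤ T ^ 2 := by
    have e : T ^ 2 = 2 * KA * KB * Φ ^ 4 * Lq ^ 2 * LN ^ 4 * (N : ℝ) ^ (1 + 3 * σ₁) * H ^ 2 := by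
      rw [hT, mul_pow, mul_pow, mul_pow, mul_pow, mul_pow, Real.sq_sqrt (by positivity), hP2]; ring
    have hN13 : 0 ≤ (N : ℝ) ^ (1 + 3 * σ₁) := Real.rpow_nonneg hn0.le _
    have hH0 : (0:ℝ) ≤ H := Nat.cast_nonneg H
    have h0 : 0 ≤ KA * KB * Φ ^ 4 * Lq ^ 2 * LN ^ 4 := by positivity
    calc A * B = KA * KB * Φ ^ 4 * Lq ^ 2 * LN ^ 4 * ((N : ℝ) ^ (2 * σ₁ + 1) * (N : ℝ) ^ (2 * σ₁)) * H := by
          rw [hA, hB]; ring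
      _ = KA * KB * Φ ^ 4 * Lq ^ 2 * LN ^ 4 * ((N : ℝ) ^ (1 + 3 * σ₁) * (N : ℝ) ^ σ₁) * H := by rw [hNsplit]
      _ ≤ KA * KB * Φ ^ 4 * Lq ^ 2 * LN ^ 4 * ((N : ℝ) ^ (1 + 3 * σ₁) * (2 * H)) * H :=
          mul_le_mul_of_nonneg_right (mul_le_mul_of_nonneg_left (mul_le_mul_of_nonneg_left hNσH hN13) h0) hH0
      _ = T ^ 2 := by rw [e]; ring
  calc |BIL a b N'' H| = Real.sqrt (BIL a b N'' H ^ 2) := (Real.sqrt_sq_eq_abs _).symm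
    _ ≤ Real.sqrt (T ^ 2) := Real.sqrt_le_sqrt (hsq.trans hT2)
    _ = T := Real.sqrt_sq hT0
    _ = _ := by rw [hT]

/-! ### The final estimate -/

omit [NeZero q] in
/-- For `1 ≤ y ≤ 2N`: `y^{1+σ₁+ε} ≤ 4 e⁴ N^{1+σ₁}` (`ε = 2/log N`, `N ≥ 2`, `0 ≤ σ₁ ≤ 1`). [folklore] -/
theorem rpow_one_sigma_le {n y σ₁ : ℝ} (hn : 2 ≤ n) (hy1 : 1 ≤ y) (hy : y ≤ 2 * n) (hσ₁0 : 0 ≤ σ₁) (hσ₁ : σ₁ ≤ 1) :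
    y ^ (1 + σ₁ + 2 / Real.log n) ≤ 4 * Real.exp 4 * n ^ (1 + σ₁) := by
  have hn1 : 1 < n := by linarith
  have hn0 : 0 < n := by linarith
  have hε0 : 0 < 2 / Real.log n := div_pos two_pos (Real.log_pos hn1)
  have h2n : y ≤ n ^ 2 := hy.trans (by nlinarith)
  rw [Real.rpow_add (by linarith)]
  have h1 : y ^ (1 + σ₁) ≤ (2 * n) ^ (1 + σ₁) := Real.rpow_le_rpow (by linarith) hy (by linarith)
  have h2 : (2 * n) ^ (1 + σ₁) = 2 ^ (1 + σ₁) * n ^ (1 + σ₁) := Real.mul_rpow (by norm_num) hn0.le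
  have h3 : (2 : ℝ) ^ (1 + σ₁) ≤ 2 ^ (2 : ℝ) := Real.rpow_le_rpow_of_exponent_le (by norm_num) (by linarith)
  have h4 : y ^ (2 / Real.log n) ≤ (n ^ 2) ^ (2 / Real.log n) := Real.rpow_le_rpow (by linarith) h2n hε0.le
  have h5 : (n ^ 2) ^ (2 / Real.log n) = Real.exp 4 := by
    rw [← Real.rpow_natCast n 2, ← Real.rpow_mul hn0.le, show ((2 : ℕ) : ℝ) * (2 / Real.log n) = 2 * (2 / Real.log n) by
      push_cast; ring, rpow_mul_two_div_log hn1]; norm_num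
  have hnp : 0 ≤ n ^ (1 + σ₁) := Real.rpow_nonneg hn0.le _
  calc y ^ (1 + σ₁) * y ^ (2 / Real.log n) ≤ (2 ^ (2 : ℝ) * n ^ (1 + σ₁)) * Real.exp 4 := by
        refine mul_le_mul (h1.trans (by rw [h2]; gcongr)) (h4.trans h5.le) (Real.rpow_nonneg (by linarith) _)
          (by positivity)
    _ = 4 * Real.exp 4 * n ^ (1 + σ₁) := by norm_num; ring

set_option maxHeartbeats 4000000 in
/-- **The summed error terms** over `M = N'' + 1 + j`, `j < H = ⌊N^{σ₁}⌋` (`N'' ≤ N ≤ 2N''`): given the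
log-free bound `|R₁(x)| ≤ C_D φ (log q+1) x^{1+σ₁+ε}` for the two classes (this is
`abs_rieszMean_sub_le`, passed as a hypothesis to share its constant),
`|∑_j (S₂(M_j) − M_j²/2)| ≤ H (8e⁴ C_D φ(log q+1) N^{1+σ₁} + 4N) + √(2K_AK_B) φ²(log q+1)²(log N+1)² N^{1+σ₁}N^{-(1−σ₁)/2} H`.
[folklore] -/
theorem abs_sumErr_le {a b : ZMod q} (ha : IsUnit a) (hb : IsUnit b) {σ₁ : ℝ} (hσ₁ : 1 / 2 ≤ σ₁)
    (hZ : ZerosRealPartLE q σ₁) {N N'' : ℕ} (hN : 16 ≤ N) (hσN : σ₁ + 4 / Real.log N ≤ 1)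
    (hN''u : N'' ≤ N) (hN''l : (N : ℝ) ≤ 2 * N'') {CD : ℝ} (hCD0 : 0 ≤ CD)
    (hCDa : ∀ x : ℝ, 1 ≤ x → 1 ≤ 2 / Real.log N * Real.log x →
      |R1 a x| ≤ CD * q.totient * (Real.log q + 1) * x ^ (1 + σ₁ + 2 / Real.log N))
    (hCDb : ∀ x : ℝ, 1 ≤ x → 1 ≤ 2 / Real.log N * Real.log x →
      |R1 b x| ≤ CD * q.totient * (Real.log q + 1) * x ^ (1 + σ₁ + 2 / Real.log N)) :
    |∑ j ∈ range ⌊(N : ℝ) ^ σ₁⌋₊, (S2 a b (N'' + 1 + j) - ((N'' + 1 + j : ℕ) : ℝ) ^ 2 / 2)| ≤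
      ⌊(N : ℝ) ^ σ₁⌋₊ * (8 * Real.exp 4 * CD * q.totient * (Real.log q + 1) * (N : ℝ) ^ (1 + σ₁) + 4 * N) +
        Real.sqrt (2 * KA * KB) * (q.totient : ℝ) ^ 2 * (Real.log q + 1) ^ 2 * (Real.log N + 1) ^ 2 *
          ((N : ℝ) ^ (1 + σ₁) * (N : ℝ) ^ (-((1 - σ₁) / 2))) * ⌊(N : ℝ) ^ σ₁⌋₊ := by
  obtain ⟨hn, hlog2, hε0, hσ'1, hσ₁1, -⟩ := basic_facts hN hσ₁ hσN
  obtain ⟨hHle, hHge, hH4, hHn, -⟩ := floor_rpow_facts hn hσ₁ hσN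
  set H : ℕ := ⌊(N : ℝ) ^ σ₁⌋₊ with hHdef
  have hn0 : (0 : ℝ) < N := by linarith
  have he4 : (54 : ℝ) ≤ Real.exp 4 := by
    have h27 : (2.7182818283 : ℝ) < Real.exp 1 := Real.exp_one_gt_d9
    have h2 : Real.exp 4 = (Real.exp 1) ^ 4 := by rw [← Real.exp_nat_mul]; norm_num
    rw [h2]
    have := pow_le_pow_left₀ (by norm_num) h27.le 4
    exact le_trans (by norm_num) this
  have hHN : (H : ℝ) ≤ N / 54 := hHn.trans (div_le_div_of_nonneg_left hn0.le (by norm_num) he4)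
  have hN''r : (N'' : ℝ) ≤ N := by exact_mod_cast hN''u
  have hN''1 : 1 ≤ N'' := by
    have : (1 : ℝ) ≤ N'' := by linarith
    exact_mod_cast this
  set P : ℝ := (N : ℝ) ^ (1 + σ₁) with hP
  have hP0 : 0 ≤ P := Real.rpow_nonneg hn0.le _
  set Φ : ℝ := (q.totient : ℝ) with hΦ
  have hΦ0 : 0 ≤ Φ := Nat.cast_nonneg _
  have hLq0 : 0 ≤ Real.log q + 1 := by have := Real.log_natCast_nonneg q; linarith
  -- the `R₁` bound at `x = N'' + j`
  have hR1 : ∀ (c : ZMod q), (∀ x : ℝ, 1 ≤ x → 1 ≤ 2 / Real.log N * Real.log x →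
      |R1 c x| ≤ CD * q.totient * (Real.log q + 1) * x ^ (1 + σ₁ + 2 / Real.log N)) →
      ∀ j ∈ range H, |R1 c ((N'' : ℝ) + j)| ≤ 4 * Real.exp 4 * CD * Φ * (Real.log q + 1) * P := by
    intro c hc j hj
    rw [Finset.mem_range] at hj
    have hj' : (j : ℝ) ≤ H := by exact_mod_cast hj.le
    have hj0 : (0 : ℝ) ≤ j := Nat.cast_nonneg j
    set x : ℝ := (N'' : ℝ) + j with hx
    have hx1 : (N : ℝ) / 2 ≤ x := by rw [hx]; linarith
    have hx2 : x ≤ 2 * N := by rw [hx]; linarith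
    have hxge1 : 1 ≤ x := by linarith
    have hlogx : 1 ≤ 2 / Real.log N * Real.log x := by
      have hlx : Real.log N - Real.log 2 ≤ Real.log x := by
        rw [← Real.log_div hn0.ne' (by norm_num)]
        exact Real.log_le_log (by positivity) hx1
      have hl2 : Real.log 2 ≤ 1 := by
        have := Real.log_le_sub_one_of_pos (show (0:ℝ) < 2 by norm_num); linarith
      rw [div_mul_eq_mul_div, le_div_iff₀ (by linarith)]
      linarith
    have h := hc x hxge1 hlogx
    have hpow := rpow_one_sigma_le (σ₁ := σ₁) (by linarith) hxge1 hx2 (by linarith) hσ₁1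
    calc |R1 c x| ≤ CD * q.totient * (Real.log q + 1) * x ^ (1 + σ₁ + 2 / Real.log N) := h
      _ ≤ CD * q.totient * (Real.log q + 1) * (4 * Real.exp 4 * P) := by
          refine mul_le_mul_of_nonneg_left hpow ?_
          exact mul_nonneg (mul_nonneg hCD0 hΦ0) hLq0
      _ = _ := by ring
  -- the linear terms
  have hlin : ∀ j ∈ range H, |(2 - 3 * ((N'' + 1 + j : ℕ) : ℝ)) / 2| ≤ 4 * N := by
    intro j hj
    rw [Finset.mem_range] at hj
    have hj' : (j : ℝ) + 1 ≤ H := by exact_mod_cast hj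
    have hj0 : (0 : ℝ) ≤ j := Nat.cast_nonneg j
    rw [abs_le]
    push_cast
    constructor <;> nlinarith
  -- assemble
  rw [sum_S2_sub_main_eq a b hN''1 H]
  have hBIL := abs_BIL_le ha hb hσ₁ hZ hN hσN hN''u hN''1
  rw [← hHdef] at hBIL
  have hsumA : |∑ j ∈ range H, R1 a ((N'' : ℝ) + j)| ≤ H * (4 * Real.exp 4 * CD * Φ * (Real.log q + 1) * P) := by
    refine (Finset.abs_sum_le_sum_abs _ _).trans ?_
    calc ∑ j ∈ range H, |R1 a ((N'' : ℝ) + j)| ≤ ∑ _j ∈ range H, 4 * Real.exp 4 * CD * Φ * (Real.log q + 1) * P :=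
          sum_le_sum (hR1 a hCDa)
      _ = _ := by rw [sum_const, card_range, nsmul_eq_mul]
  have hsumB : |∑ j ∈ range H, R1 b ((N'' : ℝ) + j)| ≤ H * (4 * Real.exp 4 * CD * Φ * (Real.log q + 1) * P) := by
    refine (Finset.abs_sum_le_sum_abs _ _).trans ?_
    calc ∑ j ∈ range H, |R1 b ((N'' : ℝ) + j)| ≤ ∑ _j ∈ range H, 4 * Real.exp 4 * CD * Φ * (Real.log q + 1) * P :=
          sum_le_sum (hR1 b hCDb)
      _ = _ := by rw [sum_const, card_range, nsmul_eq_mul]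
  have hsumL : |∑ j ∈ range H, (2 - 3 * ((N'' + 1 + j : ℕ) : ℝ)) / 2| ≤ H * (4 * N) := by
    refine (Finset.abs_sum_le_sum_abs _ _).trans ?_
    calc ∑ j ∈ range H, |(2 - 3 * ((N'' + 1 + j : ℕ) : ℝ)) / 2| ≤ ∑ _j ∈ range H, 4 * (N : ℝ) := sum_le_sum hlin
      _ = _ := by rw [sum_const, card_range, nsmul_eq_mul]
  calc |∑ j ∈ range H, R1 a ((N'' : ℝ) + j) + ∑ j ∈ range H, R1 b ((N'' : ℝ) + j) + BIL a b N'' H +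
        ∑ j ∈ range H, (2 - 3 * ((N'' + 1 + j : ℕ) : ℝ)) / 2|
      ≤ |∑ j ∈ range H, R1 a ((N'' : ℝ) + j)| + |∑ j ∈ range H, R1 b ((N'' : ℝ) + j)| + |BIL a b N'' H| +
          |∑ j ∈ range H, (2 - 3 * ((N'' + 1 + j : ℕ) : ℝ)) / 2| := by
        have h1 := abs_add_le (∑ j ∈ range H, R1 a ((N'' : ℝ) + j) + ∑ j ∈ range H, R1 b ((N'' : ℝ) + j) + BIL a b N'' H)
          (∑ j ∈ range H, (2 - 3 * ((N'' + 1 + j : ℕ) : ℝ)) / 2)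
        have h2 := abs_add_le (∑ j ∈ range H, R1 a ((N'' : ℝ) + j) + ∑ j ∈ range H, R1 b ((N'' : ℝ) + j)) (BIL a b N'' H)
        have h3 := abs_add_le (∑ j ∈ range H, R1 a ((N'' : ℝ) + j)) (∑ j ∈ range H, R1 b ((N'' : ℝ) + j))
        linarith
    _ ≤ H * (4 * Real.exp 4 * CD * Φ * (Real.log q + 1) * P) + H * (4 * Real.exp 4 * CD * Φ * (Real.log q + 1) * P) +
          Real.sqrt (2 * KA * KB) * Φ ^ 2 * (Real.log q + 1) ^ 2 * (Real.log N + 1) ^ 2 *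
            (P * (N : ℝ) ^ (-((1 - σ₁) / 2))) * H + H * (4 * N) :=
        add_le_add (add_le_add (add_le_add hsumA hsumB) hBIL) hsumL
    _ = _ := by ring

set_option maxHeartbeats 4000000 in
/-- **Goldbach sums in two residue classes under `ZerosRealPartLE q σ₁` (any `q`).** There is an
absolute `C` such that for all `q ≥ 1`, all reduced classes `a, b`, all `σ₁ ≥ 1/2` with no zero of
any `L(s, χ)` (`χ` mod `q`) in `Re s > σ₁`, and all `N ≥ 16` with `σ₁ + 4/log N ≤ 1`:
`|S₂(N) − N²/2| ≤ C φ(q) N^{1+σ₁} ((log q + 1) + φ(q)(log q+1)²(log N+1)² N^{-(1−σ₁)/2})`,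
where `S₂(N) = ∑_{l+m ≤ N} Λ_{q,a}(l)Λ_{q,b}(m)` with `Λ_{q,a} = φ(q)Λ𝟙_{≡a}`.
[cite: BhowmikHalupczokMatsumotoSuzuki2019, Thm. 1 (1) and §3 (mean-square variant of the proof)] -/
theorem abs_S2_sub_le : ∃ C : ℝ, 0 < C ∧ ∀ (q : ℕ) [NeZero q] (a b : ZMod q), IsUnit a → IsUnit b →
    ∀ σ₁ : ℝ, 1 / 2 ≤ σ₁ → ZerosRealPartLE q σ₁ → ∀ N : ℕ, 16 ≤ N → σ₁ + 4 / Real.log N ≤ 1 →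
      |S2 a b N - (N : ℝ) ^ 2 / 2| ≤ C * q.totient * (N : ℝ) ^ (1 + σ₁) *
        ((Real.log q + 1) + q.totient * (Real.log q + 1) ^ 2 * (Real.log N + 1) ^ 2 *
          (N : ℝ) ^ (-((1 - σ₁) / 2))) := by
  obtain ⟨CD, hCD0, hCD⟩ := abs_rieszMean_sub_le
  refine ⟨16 * Real.exp 4 * CD + 2 * Real.sqrt (2 * KA * KB) + 24, by positivity, ?_⟩
  intro q _ a b ha hb σ₁ hσ₁ hZ N hN hσN
  obtain ⟨hn, hlog2, hε0, hσ'1, hσ₁1, -⟩ := basic_facts hN hσ₁ hσN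
  obtain ⟨hHle, hHge, hH4, hHn, -⟩ := floor_rpow_facts hn hσ₁ hσN
  set H : ℕ := ⌊(N : ℝ) ^ σ₁⌋₊ with hHdef
  have hn0 : (0 : ℝ) < N := by linarith
  have he4 : (54 : ℝ) ≤ Real.exp 4 := by
    have h27 : (2.7182818283 : ℝ) < Real.exp 1 := Real.exp_one_gt_d9
    have h2 : Real.exp 4 = (Real.exp 1) ^ 4 := by rw [← Real.exp_nat_mul]; norm_num
    rw [h2]
    have := pow_le_pow_left₀ (by norm_num) h27.le 4
    exact le_trans (by norm_num) this
  have hHN : (H : ℝ) ≤ N / 54 := hHn.trans (div_le_div_of_nonneg_left hn0.le (by norm_num) he4)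
  have hH1r : (1 : ℝ) ≤ H := by linarith
  have hH1 : 1 ≤ H := by exact_mod_cast hH1r
  have hH2N : H + 2 ≤ N := by
    have : (H : ℝ) + 2 ≤ N := by linarith
    exact_mod_cast this
  set P : ℝ := (N : ℝ) ^ (1 + σ₁) with hP
  have hP0 : 0 ≤ P := Real.rpow_nonneg hn0.le _
  set Φ : ℝ := (q.totient : ℝ) with hΦ
  have hΦ1 : (1 : ℝ) ≤ Φ := by
    rw [hΦ]; exact_mod_cast Nat.succ_le_of_lt (Nat.totient_pos.2 (NeZero.pos q))
  set Lq1 : ℝ := Real.log q + 1 with hLq1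
  have hLq1' : 1 ≤ Lq1 := by have := Real.log_natCast_nonneg q; rw [hLq1]; linarith
  set Sv : ℝ := (N : ℝ) ^ (-((1 - σ₁) / 2)) with hSv
  have hSv0 : 0 ≤ Sv := Real.rpow_nonneg hn0.le _
  set LN : ℝ := Real.log N + 1 with hLN
  -- `N H ≤ P`, `N ≤ P`
  have hNH : (N : ℝ) * H ≤ P := by
    calc (N : ℝ) * H ≤ (N : ℝ) * (N : ℝ) ^ σ₁ := mul_le_mul_of_nonneg_left hHle hn0.le
      _ = P := by rw [hP, Real.rpow_add hn0, Real.rpow_one]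
  have hNP : (N : ℝ) ≤ P := by
    calc (N : ℝ) = (N : ℝ) ^ (1 : ℝ) := (Real.rpow_one _).symm
      _ ≤ P := Real.rpow_le_rpow_of_exponent_le (by linarith) (by linarith)
  -- the `R₁` hypotheses from `abs_rieszMean_sub_le`
  have hCDa : ∀ x : ℝ, 1 ≤ x → 1 ≤ 2 / Real.log N * Real.log x →
      |R1 a x| ≤ CD * q.totient * (Real.log q + 1) * x ^ (1 + σ₁ + 2 / Real.log N) :=
    fun x hx hlx ↦ hCD q a ha σ₁ hσ₁ hZ (2 / Real.log N) hε0 hσ'1 x hx hlx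
  have hCDb : ∀ x : ℝ, 1 ≤ x → 1 ≤ 2 / Real.log N * Real.log x →
      |R1 b x| ≤ CD * q.totient * (Real.log q + 1) * x ^ (1 + σ₁ + 2 / Real.log N) :=
    fun x hx hlx ↦ hCD q b hb σ₁ hσ₁ hZ (2 / Real.log N) hε0 hσ'1 x hx hlx
  -- the two averages
  have hEu := abs_sumErr_le ha hb hσ₁ hZ hN hσN le_rfl (by linarith) hCD0.le hCDa hCDb
  have hN'u : N - H - 1 ≤ N := by omega
  have hN'l : (N : ℝ) ≤ 2 * ((N - H - 1 : ℕ) : ℝ) := by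
    rw [Nat.cast_sub (by omega), Nat.cast_sub (by omega)]; push_cast; linarith
  have hEl := abs_sumErr_le ha hb hσ₁ hZ hN hσN hN'u hN'l hCD0.le hCDa hCDb
  rw [← hHdef] at hEu hEl
  have hsq := abs_S2_sub_le_of_averages a b hH1 hH2N
  -- combine
  have hH0 : (0 : ℝ) < H := by linarith
  set E₀ : ℝ := 8 * Real.exp 4 * CD * Φ * Lq1 * P + 4 * N with hE₀
  set B₀ : ℝ := Real.sqrt (2 * KA * KB) * Φ ^ 2 * Lq1 ^ 2 * LN ^ 2 * (P * Sv) with hB₀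
  have hB₀0 : 0 ≤ B₀ := by positivity
  have hdiv : (|∑ j ∈ range H, (S2 a b (N + 1 + j) - ((N + 1 + j : ℕ) : ℝ) ^ 2 / 2)| +
      |∑ j ∈ range H, (S2 a b (N - H - 1 + 1 + j) - ((N - H - 1 + 1 + j : ℕ) : ℝ) ^ 2 / 2)|) / H ≤
      2 * E₀ + 2 * B₀ := by
    rw [div_le_iff₀ hH0]
    have : |∑ j ∈ range H, (S2 a b (N + 1 + j) - ((N + 1 + j : ℕ) : ℝ) ^ 2 / 2)| +
        |∑ j ∈ range H, (S2 a b (N - H - 1 + 1 + j) - ((N - H - 1 + 1 + j : ℕ) : ℝ) ^ 2 / 2)| ≤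
        (H * E₀ + B₀ * H) + (H * E₀ + B₀ * H) := add_le_add hEu hEl
    linarith
  have hmain : 2 * (N : ℝ) * (H + 1) + 2 * ((N : ℝ) + H) * H ≤ 8 * P := by
    have h1 : (H : ℝ) + 1 ≤ 2 * H := by linarith
    have h2 : (N : ℝ) + H ≤ 2 * N := by linarith
    nlinarith [mul_le_mul_of_nonneg_left h1 (by linarith : (0:ℝ) ≤ 2 * N),
      mul_le_mul_of_nonneg_right h2 (by linarith : (0:ℝ) ≤ 2 * H)]
  calc |S2 a b N - (N : ℝ) ^ 2 / 2|
      ≤ (|∑ j ∈ range H, (S2 a b (N + 1 + j) - ((N + 1 + j : ℕ) : ℝ) ^ 2 / 2)| +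
          |∑ j ∈ range H, (S2 a b (N - H - 1 + 1 + j) - ((N - H - 1 + 1 + j : ℕ) : ℝ) ^ 2 / 2)|) / H +
        (2 * (N : ℝ) * (H + 1) + 2 * ((N : ℝ) + H) * H) := hsq
    _ ≤ (2 * E₀ + 2 * B₀) + 8 * P := add_le_add hdiv hmain
    _ ≤ (16 * Real.exp 4 * CD + 2 * Real.sqrt (2 * KA * KB) + 24) * Φ * P * (Lq1 + Φ * Lq1 ^ 2 * LN ^ 2 * Sv) := by
        rw [hE₀, hB₀]
        have hΦP : 0 ≤ Φ * P := by positivity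
        have hx1 : (1 : ℝ) ≤ Φ * Lq1 := by nlinarith
        -- `8N ≤ 8 Φ P Lq1`, `8P ≤ 8 Φ P Lq1`
        have e1 : (N : ℝ) ≤ Φ * P * Lq1 := by nlinarith
        have e2 : P ≤ Φ * P * Lq1 := by nlinarith
        have f1 : 0 ≤ Real.exp 4 * CD * (Φ * P) * (Φ * Lq1 ^ 2 * LN ^ 2 * Sv) := by positivity
        have f2 : 0 ≤ Real.sqrt (2 * KA * KB) * (Φ * P) * Lq1 := by positivity
        have f3 : 0 ≤ (Φ * P) * (Φ * Lq1 ^ 2 * LN ^ 2 * Sv) := by positivity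
        have expand : (16 * Real.exp 4 * CD + 2 * Real.sqrt (2 * KA * KB) + 24) * Φ * P * (Lq1 + Φ * Lq1 ^ 2 * LN ^ 2 * Sv) =
            16 * (Real.exp 4 * CD * Φ * Lq1 * P) + 16 * (Real.exp 4 * CD * (Φ * P) * (Φ * Lq1 ^ 2 * LN ^ 2 * Sv)) +
            2 * (Real.sqrt (2 * KA * KB) * (Φ * P) * Lq1) +
            2 * (Real.sqrt (2 * KA * KB) * Φ ^ 2 * Lq1 ^ 2 * LN ^ 2 * (P * Sv)) +
            24 * (Φ * P * Lq1) + 24 * ((Φ * P) * (Φ * Lq1 ^ 2 * LN ^ 2 * Sv)) := by ring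
        rw [expand]
        linarith [e1, e2, f1, f2, f3]

end Literature.NumberTheory.LFunctions.ResidueRiesz

end
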